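import Literature.NumberTheory.Sieve.LinearEquationsInPrimesEnvelopingSieveGYLinearForms
import HarnessLib

/-!
# The correlation estimate for the enveloping sieve, proved from the smooth Goldston–Yıldırım engine

Trunk T-SIEVE (`Literature/NumberTheory/Sieve`). Part of the App. D layer of the decomposition of
`Literature.NumberTheory.Sieve.GreenTaoZiegler2012_finiteComplexity`. This file DISCHARGES the named
fact `Literature.NumberTheory.Sieve.GreenTao2010_envelopingSieve_correlations` of
`LinearEquationsInPrimesEnvelopingSieveFacts.lean` — B. Green, T. Tao, *Linear equations in primes*,
Ann. of Math. 171 (2010), App. D, proof of Prop. 6.4, the correlation estimate: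

> "we split up `ν̃` and reduce to showing that
> `(φ(W)/W)^m ∑_{n ∈ I} ∏_{j∈[m]} Λ_{χ,R,2}(W(n + h_j) + b_{i_j}) ≪ N ∑_{1≤j<j'≤m} τ(h_j - h_{j'})` …
> Once again we apply Theorem D.3 … The only difference now is that `P_Ψ ≠ ∅` … if we set
> `τ(n) := ∑_{1 ≤ j < j' ≤ m} exp(O(∑_{p > w, p ∣ Wn + b_{i_j} - b_{i_{j'}}} p^{-1/2}))` then we obtain the
> desired correlation estimate"

(`theorem GreenTao2010_envelopingSieve_correlations_holds`). Together with
`GreenTao2010_envelopingSieve_linearForms_holds` (`…EnvelopingSieveGYLinearForms.lean`) this makes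
Prop. 6.4 (`GreenTao2010_pseudorandomDomination`) a theorem of the tree, and the Green–Tao–Ziegler
theorem rests on Thm. 7.2 (`GreenTao2010_gowersUniformity`: `GI(s)`, `MN(s)`) alone.

## The proof as formalised

Thm. D.3 for a correlation system is the degenerate case of the Goldston–Yıldırım computation: the
forms `n + h_j` have equal linear parts, so the engine of D. Conlon, J. Fox, Y. Zhao, *The Green–Tao
theorem: an exposition*, EMS Surv. Math. Sci. 1 (2014), §9 (the tree's `SmoothMajorant*` files) does
not apply as packaged (its `Setup` asks for pairwise non-proportional rows), but all of its analysis
except the local densities does. Only an UPPER bound is needed.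

* The system (`corrL`, `θ_i(x) = W(x + e_i) + 1`): by the residue trick of the linear forms file
  (`EnvelopingSieveGY.truncDivisorSum_shift`) `Λ_{χ,R,2}(W(n+h_j) + b_j) = Λ_{χ,R,2}(W(n + e_j) + 1)`,
  `e_j = h_j + k_j`, `W k_j + 1 ≡ b_j (mod ∏_{w<p≤R} p)`; the `k_j` are chosen (`exists_good_shifts`)
  so that the `e_j` are pairwise distinct and `0 ≤ k_j ≤ M(1 + m(2N + M + 1))`.
* Local densities at a prime `q ∤ W` (`corr_localDensity₀_*`): `ω_q({i}) = 1/q`, `ω_q(X) ≤ 1/q`, and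
  `ω_q(X) = 0` whenever `X ∋ i ≠ i'` with `q ∤ e_i - e_{i'}` (a *generic* prime). Hence
  (`sum_smallPatterns_eq_eulerMain`, the tree's computation isolated) `E_q` IS the main term
  `1 - q^{-1}∑_j(q^{-z_j} + q^{-z'_j} - q^{-z_j-z'_j})` at a generic prime, and differs from it by
  `≤ 4^m/q` at an exceptional one; so `E_q = E'_q(1 + δ'_q)` with `|δ'_q| ≤ deltaConst/q²` resp.
  `deltaConst/q` (`norm_corr_delta_le_*`), `∑_q |δ'_q| ≤ deltaConst (1/w + X)`,
  `X = ∑_{q > w, q ∣ ∏_{i<i'}(e_i - e_{i'})} 1/q` (`tsum_norm_corr_deltaSeq_le`) — Green–Tao's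
  `e^{O(X)}`, `X = ∑_{p ∈ P_Ψ} p^{-1/2}`, in the form the Fourier method gives (`1/q ≤ q^{-1/2}`).
* The dominator (`exists_corr_dominator`): `|∏_{p<Q} E_p(z(η))| ≤ (log R + C)^{3m} e^{deltaConst(1/w + X)}`
  uniformly (`|E'_p| ≤ (1 - p^{-σ})^{-3m}`, `∏ ≤ |ζ(σ)|^{3m}`, `σ = 1 + 1/log R`); with the tree's
  `tendsto_prod_eulerFactor` and dominated convergence, the tuple sum is `∫ Φ · Lim` exactly
  (`corr_trueSumC_eq_integral`).
* The bound (`norm_corr_trueSumC_le`): on the box `|η_v| ≤ T` the tree's pointwise comparison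
  `norm_limit_sub_main_le` with the correction product bounded by `e^{∑|δ'|}` (not close to `1`) gives
  `|Lim| ≤ (1+α)(1+2β)e^{deltaConst(1/w+X)} |mainZ| (W/φ(W))^m`, `∫|Φ||mainZ| ≤ (2 log R)^{-m} M₂^{2m}`;
  off the box the dominator times the tail of `Φ` (`T = (log R)^{1/2}`, decay exponent `14m + 2`).
* Assembly (`corr_fixed_bound`, `correlations_of_abs_le_one`): monotonicity in the interval
  (`Λ_{χ,R,2} ≥ 0`, so `I ⊆ [-N, N]` of length `2N + 1 ≥ R^{5m}`, `γ ≤ 1/(10m)`), the expectation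
  identity of the tree in one variable (`corr_interval_sum_le`), the smallness of `α, β, δ` uniformly
  in `w ≤ (log R)^{1/8}` (`corr_smallness`), whence
  `(φ(W)/W)^m ∑ ≤ 3 C₁ e^{deltaConst} e^{deltaConst X} N`; then `X ≤ ∑_{i<i'} ∑_{p>w, p∣Δ_{ii'}} p^{-1/2} + O_m(1)`
  (`excSum_le_pairs_roughSum`: an exceptional prime `q ≤ R` divides
  `Δ_{ii'} = W(h_i - h_{i'}) + b_i - b_{i'}` because both `Wk + 1 - b` are divisible by
  `∏_{w<p≤R} p ∋ q`; the *parasitic* primes `q > R` dividing `e_i - e_{i'}` — an artefact of the residue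
  trick — number `≤ log|e_i - e_{i'}|/log R` and contribute `O(1)`, `parasitic_le`), and
  `e^{C∑_{pairs} Y} ≤ ∑_{pairs} e^{#pairs·C·Y}` gives the printed pair sum; finally scaling `χ = sχ₁`.

## References

* B. Green, T. Tao, *Linear equations in primes*, Ann. of Math. (2) 171 (2010), 1753–1850
  (arXiv:math/0606088): App. D, Thm. D.3 (with the exceptional primes `P_Ψ` and the factor `e^{O(X)}`)
  and the proof of Prop. 6.4 (verification of the correlation condition). [cite: GreenTao2010]
* D. Conlon, J. Fox, Y. Zhao, *The Green–Tao theorem: an exposition*, EMS Surv. Math. Sci. 1 (2014),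
  249–282, §9 (the engine). [cite: ConlonFoxZhao2014]
* B. Green, T. Tao, *The primes contain arbitrarily long arithmetic progressions*, Ann. of Math. (2)
  167 (2008), Prop. 9.6 and Lemma 9.10 (the ancestor, with `∏_{p∣Δ}(1 + O(p^{-1/2}))`), for comparison.
-/

noncomputable section

open Finset MeasureTheory Filter Topology
open scoped BigOperators

namespace Literature.NumberTheory.Sieve

namespace EnvelopingSieveGY

open Literature.NumberTheory.Sieve.CFZ Literature.NumberTheory.Sieve.GreenTao2008

/-! ### The correlation system `θ_i(x) = W(x + e_i) + 1` in the format of the engine -/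

/-- The one-column all-ones coefficient matrix: the forms `x + e_i` of a correlation.
[cite: GreenTao2010, App. D (proof of Prop. 6.4, the correlation condition)] -/
def corrL (m : ℕ) : Fin m → Fin 1 → ℤ := fun _ _ => 1

variable {m : ℕ}

/-- `θ_i(x) - θ_{i'}(x) = W (e_i - e_{i'})` in any commutative ring. [folklore] -/
theorem wForm_corrL_sub {R : Type*} [CommRing R] (W : ℕ) (e : Fin m → ℤ) (i i' : Fin m) (x : Fin 1 → R) :
    wForm W (corrL m i) (e i) x - wForm W (corrL m i') (e i') x = (W : R) * ((e i : R) - (e i' : R)) := by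
  simp only [wForm, corrL]
  ring

/-- `ω_q({i}) = 1/q` for `q ∤ W`. [cite: ConlonFoxZhao2014, Section 9] -/
theorem corr_localDensity₀_singleton {q W : ℕ} [Fact q.Prime] (hqW : ¬ q ∣ W) (e : Fin m → ℤ) (i : Fin m) :
    localDensity₀ q W (corrL m) e {i} = 1 / q := by
  haveI : NeZero q := ⟨(Fact.out : q.Prime).ne_zero⟩
  rw [localDensity₀_eq]
  refine localDensity_singleton hqW (corrL m) e i (j₀ := 0) ?_
  simp [corrL]

/-- `ω_q(X) ≤ 1/q` for `q ∤ W` and `X ≠ ∅`. [cite: ConlonFoxZhao2014, Section 9] -/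
theorem corr_localDensity₀_le {q W : ℕ} [Fact q.Prime] (hqW : ¬ q ∣ W) (e : Fin m → ℤ) {X : Finset (Fin m)}
    {i : Fin m} (hi : i ∈ X) : localDensity₀ q W (corrL m) e X ≤ 1 / q := by
  haveI : NeZero q := ⟨(Fact.out : q.Prime).ne_zero⟩
  rw [localDensity₀_eq, ← corr_localDensity₀_singleton hqW e i, localDensity₀_eq]
  exact localDensity_mono (corrL m) e (singleton_subset_iff.2 hi)

/-- **Generic primes**: if `q ∤ W` and `q ∤ e_i - e_{i'}` then no `x` solves both `θ_i(x) ≡ 0` and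
`θ_{i'}(x) ≡ 0 (mod q)`, so `ω_q(X) = 0` for every `X ⊇ {i, i'}`.
[cite: GreenTao2010, App. D (Thm. D.3: the local factors of a correlation system)] -/
theorem corr_localDensity₀_eq_zero {q W : ℕ} [Fact q.Prime] (hqW : ¬ q ∣ W) (e : Fin m → ℤ) {X : Finset (Fin m)}
    {i i' : Fin m} (hi : i ∈ X) (hi' : i' ∈ X) (hgen : ¬ (q : ℤ) ∣ e i - e i') :
    localDensity₀ q W (corrL m) e X = 0 := by
  have hq : q.Prime := Fact.out
  haveI : NeZero q := ⟨hq.ne_zero⟩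
  rw [localDensity₀_eq]
  unfold CFZ.localDensity
  rw [filter_false_of_mem, card_empty, Nat.cast_zero, zero_div]
  intro x _ hx
  have h1 := hx i hi
  have h2 := hx i' hi'
  have hsub := wForm_corrL_sub (R := ZMod q) W e i i' x
  rw [h1, h2, sub_self] at hsub
  have hW : (W : ZMod q) ≠ 0 := fun h => hqW ((ZMod.natCast_eq_zero_iff W q).1 h)
  have he : ((e i : ZMod q) - (e i' : ZMod q)) = 0 := by
    rcases mul_eq_zero.1 hsub.symm with h | h
    · exact absurd h hW
    · exact h
  apply hgen
  rw [← ZMod.intCast_zmod_eq_zero_iff_dvd]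
  push_cast
  exact he

/-! ### The Euler factor of the correlation system at a prime `q ∤ W` -/

/-- **The small patterns give the main term** (generic in the system): if `ω_p({j}) = 1/p` for
all `j` then `∑_{#π(Y) ≤ 1} ω_p(π Y) ∏_{i ∈ Y}(-p^{-w_i}) = 1 - p^{-1}∑_j (p^{-z_j} + p^{-z'_j} - p^{-z_j-z'_j})`
(the tree's computation inside `CFZ.norm_eulerFactor_sub_main_le`, isolated).
[cite: ConlonFoxZhao2014, Section 9] -/
theorem sum_smallPatterns_eq_eulerMain {t p W : ℕ} [Fact p.Prime] (L : Fin m → Fin t → ℤ) (b : Fin m → ℤ)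
    (z z' : Fin m → ℂ) (hω : ∀ j, localDensity₀ p W L b {j} = 1 / p) :
    ∑ Y ∈ (univ : Finset (Finset (Fin m ⊕ Fin m))).filter (fun Y => #(projPattern Y) ≤ 1),
        (localDensity₀ p W L b (projPattern Y) : ℂ) * ∏ i ∈ Y, -((p : ℂ) ^ (-(sumExp z z' i))) =
      eulerMain p z z' := by
  classical
  have hp : p.Prime := Fact.out
  haveI : NeZero p := ⟨hp.ne_zero⟩
  set T : Finset (Fin m ⊕ Fin m) → ℂ := fun Y =>
    (localDensity₀ p W L b (projPattern Y) : ℂ) * ∏ i ∈ Y, -((p : ℂ) ^ (-(sumExp z z' i))) with hT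
  show ∑ Y ∈ (univ : Finset (Finset (Fin m ⊕ Fin m))).filter (fun Y => #(projPattern Y) ≤ 1), T Y = eulerMain p z z'
  have hset : (univ : Finset (Finset (Fin m ⊕ Fin m))).filter (fun Y => #(projPattern Y) ≤ 1) =
      insert ∅ ((univ : Finset (Fin m)).biUnion fun j =>
        (univ : Finset (Finset (Fin m ⊕ Fin m))).filter fun Y => projPattern Y = {j}) := by
    ext Y
    simp only [mem_filter, mem_univ, true_and, mem_insert, mem_biUnion]
    constructor
    · intro h
      rcases Nat.lt_or_ge (#(projPattern Y)) 1 with h0 | h1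
      · left
        exact projPattern_eq_empty_iff.1 (card_eq_zero.1 (by omega))
      · right
        obtain ⟨j, hj⟩ := card_eq_one.1 (le_antisymm h h1)
        exact ⟨j, hj⟩
    · rintro (rfl | ⟨j, hj⟩)
      · simp
      · rw [hj, card_singleton]
  have hnotin : (∅ : Finset (Fin m ⊕ Fin m)) ∉ (univ : Finset (Fin m)).biUnion fun j =>
      (univ : Finset (Finset (Fin m ⊕ Fin m))).filter fun Y => projPattern Y = {j} := by
    simp only [mem_biUnion, mem_univ, true_and, mem_filter, projPattern_empty, not_exists]
    intro j h
    exact (singleton_ne_empty j) h.symm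
  have hdisj : ((univ : Finset (Fin m)) : Set (Fin m)).PairwiseDisjoint fun j =>
      (univ : Finset (Finset (Fin m ⊕ Fin m))).filter fun Y => projPattern Y = {j} := by
    intro j _ j' _ hjj'
    simp only [Function.onFun, disjoint_left, mem_filter, mem_univ, true_and]
    intro Y hY hY'
    rw [hY] at hY'
    exact hjj' (singleton_injective hY')
  rw [hset, sum_insert hnotin, sum_biUnion hdisj]
  rw [sum_congr rfl fun j _ => sum_filter_projPattern_eq_singleton L b z z' j]
  have hT0 : T ∅ = 1 := by simp [hT, localDensity₀_empty]
  simp only [hT0, hω]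
  unfold eulerMain
  push_cast
  rw [mul_sum]
  have : ∀ j : Fin m, (1 / (p : ℂ)) * (-((p : ℂ) ^ (-(z j))) - (p : ℂ) ^ (-(z' j)) + (p : ℂ) ^ (-(z j + z' j))) =
      -((p : ℂ)⁻¹ * ((p : ℂ) ^ (-(z j)) + (p : ℂ) ^ (-(z' j)) - (p : ℂ) ^ (-(z j + z' j)))) := by
    intro j; ring
  simp_rw [this, sum_neg_distrib]
  ring

/-- The number of patterns is `4^m`. [folklore] -/
theorem card_patterns (m : ℕ) : (#(univ : Finset (Finset (Fin m ⊕ Fin m))) : ℝ) = 4 ^ m := by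
  rw [card_univ, Fintype.card_finset, Fintype.card_sum, Fintype.card_fin]
  push_cast
  rw [← two_mul, pow_mul]; norm_num

/-- **`E_q = E_q^{main} + O(A)`** for the correlation system at `q ∤ W`: if every pattern hitting two
indices has density `≤ A` then `‖E_q - (1 - q^{-1}∑_j(…))‖ ≤ 4^m A`. [cite: ConlonFoxZhao2014, Section 9]
[cite: GreenTao2010, App. D (Thm. D.3)] -/
theorem norm_corrEulerFactor_sub_main_le {q W : ℕ} [Fact q.Prime] (hqW : ¬ q ∣ W) (e : Fin m → ℤ)
    {A : ℝ} (hA0 : 0 ≤ A)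
    (hA : ∀ X : Finset (Fin m), ∀ i ∈ X, ∀ i' ∈ X, i ≠ i' → localDensity₀ q W (corrL m) e X ≤ A)
    {z z' : Fin m → ℂ} (hz : ∀ j, 0 ≤ (z j).re) (hz' : ∀ j, 0 ≤ (z' j).re) :
    ‖eulerFactor q W (corrL m) e z z' - eulerMain q z z'‖ ≤ 4 ^ m * A := by
  classical
  have hq : q.Prime := Fact.out
  set T : Finset (Fin m ⊕ Fin m) → ℂ := fun Y =>
    (localDensity₀ q W (corrL m) e (projPattern Y) : ℂ) * ∏ i ∈ Y, -((q : ℂ) ^ (-(sumExp z z' i))) with hT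
  have hsplit : eulerFactor q W (corrL m) e z z' =
      ∑ Y ∈ (univ : Finset (Finset (Fin m ⊕ Fin m))).filter (fun Y => #(projPattern Y) ≤ 1), T Y +
        ∑ Y ∈ (univ : Finset (Finset (Fin m ⊕ Fin m))).filter (fun Y => ¬ #(projPattern Y) ≤ 1), T Y := by
    unfold eulerFactor
    rw [sum_filter_add_sum_filter_not]
  have hsmall := sum_smallPatterns_eq_eulerMain (corrL m) e z z' (fun j => corr_localDensity₀_singleton hqW e j)
  have hlarge : ∀ Y ∈ (univ : Finset (Finset (Fin m ⊕ Fin m))).filter (fun Y => ¬ #(projPattern Y) ≤ 1),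
      ‖T Y‖ ≤ A := by
    intro Y hY
    have hcard : 1 < #(projPattern Y) := not_le.1 (mem_filter.1 hY).2
    obtain ⟨i, hi, i', hi', hii'⟩ := one_lt_card.1 hcard
    have hω := hA (projPattern Y) i hi i' hi' hii'
    have hω0 := (localDensity₀_nonneg_le_one q W (corrL m) e (projPattern Y)).1
    simp only [hT, norm_mul, Complex.norm_real, Real.norm_eq_abs, abs_of_nonneg hω0]
    calc localDensity₀ q W (corrL m) e (projPattern Y) * ‖∏ i ∈ Y, -((q : ℂ) ^ (-(sumExp z z' i)))‖
        ≤ A * 1 := mul_le_mul hω (norm_prod_neg_cpow_le hq.pos hz hz' Y) (norm_nonneg _) hA0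
      _ = A := mul_one _
  rw [hsplit, hsmall, add_sub_cancel_left]
  calc ‖∑ Y ∈ (univ : Finset (Finset (Fin m ⊕ Fin m))).filter (fun Y => ¬ #(projPattern Y) ≤ 1), T Y‖
      ≤ ∑ Y ∈ (univ : Finset (Finset (Fin m ⊕ Fin m))).filter (fun Y => ¬ #(projPattern Y) ≤ 1), ‖T Y‖ :=
        norm_sum_le _ _
    _ ≤ ∑ _Y ∈ (univ : Finset (Finset (Fin m ⊕ Fin m))).filter (fun Y => ¬ #(projPattern Y) ≤ 1), A := sum_le_sum hlarge
    _ = #((univ : Finset (Finset (Fin m ⊕ Fin m))).filter (fun Y => ¬ #(projPattern Y) ≤ 1)) * A := by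
        rw [sum_const, nsmul_eq_mul]
    _ ≤ (4 : ℝ) ^ m * A := by
        gcongr
        calc (#((univ : Finset (Finset (Fin m ⊕ Fin m))).filter (fun Y => ¬ #(projPattern Y) ≤ 1)) : ℝ)
            ≤ #(univ : Finset (Finset (Fin m ⊕ Fin m))) := by exact_mod_cast card_filter_le _ _
          _ = (4 : ℝ) ^ m := card_patterns m

/-- A prime is *generic* for the shifts `e` if it divides no difference `e_i - e_{i'}`, `i ≠ i'`.
[cite: GreenTao2010, App. D (Thm. D.3: the exceptional primes `P_Ψ`)] -/
def IsGenericPrime (e : Fin m → ℤ) (q : ℕ) : Prop := ∀ i i', i ≠ i' → ¬ (q : ℤ) ∣ e i - e i'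

/-- **Generic primes: `E_q` is the main term exactly.** [cite: GreenTao2010, App. D (Thm. D.3)] -/
theorem corrEulerFactor_eq_main {q W : ℕ} [Fact q.Prime] (hqW : ¬ q ∣ W) {e : Fin m → ℤ} (hgen : IsGenericPrime e q)
    {z z' : Fin m → ℂ} (hz : ∀ j, 0 ≤ (z j).re) (hz' : ∀ j, 0 ≤ (z' j).re) :
    eulerFactor q W (corrL m) e z z' = eulerMain q z z' := by
  have h := norm_corrEulerFactor_sub_main_le hqW e le_rfl
    (fun X i hi i' hi' hii' => (corr_localDensity₀_eq_zero hqW e hi hi' (hgen i i' hii')).le) hz hz'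
  rw [mul_zero] at h
  exact sub_eq_zero.1 (norm_le_zero_iff.1 h)

/-- **Exceptional primes: `E_q` is the main term up to `4^m/q`.** [cite: GreenTao2010, App. D (Thm. D.3)] -/
theorem norm_corrEulerFactor_sub_main_le' {q W : ℕ} [Fact q.Prime] (hqW : ¬ q ∣ W) (e : Fin m → ℤ)
    {z z' : Fin m → ℂ} (hz : ∀ j, 0 ≤ (z j).re) (hz' : ∀ j, 0 ≤ (z' j).re) :
    ‖eulerFactor q W (corrL m) e z z' - eulerMain q z z'‖ ≤ 4 ^ m / q := by
  rw [div_eq_mul_one_div]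
  exact norm_corrEulerFactor_sub_main_le hqW e (by positivity)
    (fun X i hi _ _ _ => corr_localDensity₀_le hqW e hi) hz hz'

/-- **`E_q = E'_q(1 + δ_q)` with `|δ_q| ≤ deltaConst(m)/q^k`** from `‖E_q - E_q^{main}‖ ≤ 4^m/q^k`,
`k ≤ 2` (`q ≥ 21m + 2`; the tree's `CFZ.norm_eulerFactor_div_sub_one_le` with the main-term
comparison abstracted). [cite: ConlonFoxZhao2014, Section 9] -/
theorem norm_corr_delta_le_of_main {q W : ℕ} [Fact q.Prime] (hq : 21 * m + 2 ≤ q) (e : Fin m → ℤ)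
    {z z' : Fin m → ℂ} (hz : ∀ j, 0 ≤ (z j).re) (hz' : ∀ j, 0 ≤ (z' j).re) {k : ℕ} (hk : k ≤ 2)
    (h1 : ‖eulerFactor q W (corrL m) e z z' - eulerMain q z z'‖ ≤ 4 ^ m / (q : ℝ) ^ k) :
    eulerFactor' q z z' ≠ 0 ∧
    ‖eulerFactor q W (corrL m) e z z' / eulerFactor' q z z' - 1‖ ≤ deltaConst m / (q : ℝ) ^ k := by
  have hq2 : 2 ≤ q := by omega
  have hq1 : (1 : ℝ) ≤ q := by exact_mod_cast (by omega : 1 ≤ q)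
  have hE' := norm_eulerFactor'_ge hq hz hz'
  have hne : eulerFactor' q z z' ≠ 0 := fun h => by rw [h, norm_zero] at hE'; linarith
  refine ⟨hne, ?_⟩
  have h2 := norm_eulerFactor'_sub_main_le hq2 hz hz'
  have hqk : (1 : ℝ) / (q : ℝ) ^ 2 ≤ 1 / (q : ℝ) ^ k :=
    div_le_div_of_nonneg_left zero_le_one (by positivity) (pow_le_pow_right₀ hq1 hk)
  have hdiff : ‖eulerFactor q W (corrL m) e z z' - eulerFactor' q z z'‖ ≤
      (4 ^ m + (49 * (m : ℝ) ^ 2 * (9 / 2) ^ m + 8 * m)) / (q : ℝ) ^ k := by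
    calc ‖eulerFactor q W (corrL m) e z z' - eulerFactor' q z z'‖
        = ‖(eulerFactor q W (corrL m) e z z' - eulerMain q z z') - (eulerFactor' q z z' - eulerMain q z z')‖ := by ring_nf
      _ ≤ ‖eulerFactor q W (corrL m) e z z' - eulerMain q z z'‖ + ‖eulerFactor' q z z' - eulerMain q z z'‖ := norm_sub_le _ _
      _ ≤ 4 ^ m / (q : ℝ) ^ k + (49 * (m : ℝ) ^ 2 * (9 / 2) ^ m + 8 * m) / (q : ℝ) ^ k := by
          refine add_le_add h1 (h2.trans ?_)
          rw [div_eq_mul_one_div, div_eq_mul_one_div _ ((q : ℝ) ^ k)]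
          exact mul_le_mul_of_nonneg_left hqk (by positivity)
      _ = _ := by ring
  rw [div_sub_one hne, norm_div]
  calc ‖eulerFactor q W (corrL m) e z z' - eulerFactor' q z z'‖ / ‖eulerFactor' q z z'‖
      ≤ ((4 ^ m + (49 * (m : ℝ) ^ 2 * (9 / 2) ^ m + 8 * m)) / (q : ℝ) ^ k) / (1 / 2) := by gcongr
    _ = deltaConst m / (q : ℝ) ^ k := by unfold deltaConst; ring

/-- **Generic prime: `|δ_q| ≤ deltaConst(m)/q²`.** [cite: GreenTao2010, App. D (Thm. D.3)] -/
theorem norm_corr_delta_le_generic {q W : ℕ} [Fact q.Prime] (hqW : ¬ q ∣ W) (hq : 21 * m + 2 ≤ q)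
    {e : Fin m → ℤ} (hgen : IsGenericPrime e q)
    {z z' : Fin m → ℂ} (hz : ∀ j, 0 ≤ (z j).re) (hz' : ∀ j, 0 ≤ (z' j).re) :
    eulerFactor' q z z' ≠ 0 ∧
    ‖eulerFactor q W (corrL m) e z z' / eulerFactor' q z z' - 1‖ ≤ deltaConst m / (q : ℝ) ^ 2 :=
  norm_corr_delta_le_of_main hq e hz hz' le_rfl
    (by rw [corrEulerFactor_eq_main hqW hgen hz hz', sub_self, norm_zero]; positivity)

/-- **Any prime `q ∤ W`: `|δ_q| ≤ deltaConst(m)/q`.** [cite: GreenTao2010, App. D (Thm. D.3)] -/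
theorem norm_corr_delta_le_exceptional {q W : ℕ} [Fact q.Prime] (hqW : ¬ q ∣ W) (hq : 21 * m + 2 ≤ q)
    (e : Fin m → ℤ) {z z' : Fin m → ℂ} (hz : ∀ j, 0 ≤ (z j).re) (hz' : ∀ j, 0 ≤ (z' j).re) :
    eulerFactor' q z z' ≠ 0 ∧
    ‖eulerFactor q W (corrL m) e z z' / eulerFactor' q z z' - 1‖ ≤ deltaConst m / q := by
  have h := norm_corr_delta_le_of_main hq e hz hz' (k := 1) (by norm_num)
    (by rw [pow_one]; exact norm_corrEulerFactor_sub_main_le' hqW e hz hz')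
  rwa [pow_one] at h

/-- **The size of the main term**: `|1 - q^{-1}∑_j(q^{-z_j} + q^{-z'_j} - q^{-z_j-z'_j})| ≤ 1 + 3m q^{-(1+s)}`
when `Re z_j = Re z'_j = s ≥ 0`. [cite: ConlonFoxZhao2014, Section 9, Estimate (32)] -/
theorem norm_eulerMain_le {q : ℕ} (hq : q.Prime) {z z' : Fin m → ℂ} {s : ℝ} (hs : 0 ≤ s)
    (hzs : ∀ j, (z j).re = s) (hz's : ∀ j, (z' j).re = s) :
    ‖eulerMain q z z'‖ ≤ 1 + 3 * m * (q : ℝ) ^ (-(1 + s)) := by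
  have hq0 : (0 : ℝ) < q := by exact_mod_cast hq.pos
  have hpow : ∀ w : ℂ, w.re = s → ‖(q : ℂ) ^ (-w)‖ = (q : ℝ) ^ (-s) := fun w hw => by
    rw [Complex.norm_natCast_cpow_of_pos hq.pos]; simp [hw]
  have hpow2 : ∀ j, ‖(q : ℂ) ^ (-(z j + z' j))‖ ≤ (q : ℝ) ^ (-s) := fun j => by
    rw [Complex.norm_natCast_cpow_of_pos hq.pos]
    simp only [Complex.neg_re, Complex.add_re, hzs, hz's]
    exact Real.rpow_le_rpow_of_exponent_le (by exact_mod_cast hq.one_lt.le) (by linarith)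
  unfold eulerMain
  refine (norm_sub_le _ _).trans ?_
  rw [norm_one, norm_mul, norm_inv, Complex.norm_natCast]
  have hsum : ‖∑ j, ((q : ℂ) ^ (-(z j)) + (q : ℂ) ^ (-(z' j)) - (q : ℂ) ^ (-(z j + z' j)))‖ ≤ m * (3 * (q : ℝ) ^ (-s)) := by
    refine (norm_sum_le _ _).trans ?_
    calc ∑ j, ‖(q : ℂ) ^ (-(z j)) + (q : ℂ) ^ (-(z' j)) - (q : ℂ) ^ (-(z j + z' j))‖
        ≤ ∑ _j : Fin m, 3 * (q : ℝ) ^ (-s) := sum_le_sum fun j _ => by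
          calc ‖(q : ℂ) ^ (-(z j)) + (q : ℂ) ^ (-(z' j)) - (q : ℂ) ^ (-(z j + z' j))‖
              ≤ ‖(q : ℂ) ^ (-(z j)) + (q : ℂ) ^ (-(z' j))‖ + ‖(q : ℂ) ^ (-(z j + z' j))‖ := norm_sub_le _ _
            _ ≤ (‖(q : ℂ) ^ (-(z j))‖ + ‖(q : ℂ) ^ (-(z' j))‖) + ‖(q : ℂ) ^ (-(z j + z' j))‖ := by
                gcongr; exact norm_add_le _ _
            _ ≤ ((q : ℝ) ^ (-s) + (q : ℝ) ^ (-s)) + (q : ℝ) ^ (-s) := by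
                rw [hpow _ (hzs j), hpow _ (hz's j)]; gcongr; exact hpow2 j
            _ = 3 * (q : ℝ) ^ (-s) := by ring
      _ = m * (3 * (q : ℝ) ^ (-s)) := by rw [sum_const, card_univ, Fintype.card_fin, nsmul_eq_mul]
  calc 1 + (q : ℝ)⁻¹ * ‖∑ j, ((q : ℂ) ^ (-(z j)) + (q : ℂ) ^ (-(z' j)) - (q : ℂ) ^ (-(z j + z' j)))‖
      ≤ 1 + (q : ℝ)⁻¹ * (m * (3 * (q : ℝ) ^ (-s))) := by gcongr
    _ = 1 + 3 * m * (q : ℝ) ^ (-(1 + s)) := by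
        rw [neg_add, Real.rpow_add hq0, Real.rpow_neg_one]; ring

/-- **The absolute size of `E_q`** (`q ∤ W`): `|E_q| ≤ 1 + 3m q^{-(1+s)} + 4^m/q`.
[cite: ConlonFoxZhao2014, Section 9, Estimate (32)] [cite: GreenTao2010, App. D (Thm. D.3)] -/
theorem norm_corrEulerFactor_le {q W : ℕ} [Fact q.Prime] (hqW : ¬ q ∣ W) (e : Fin m → ℤ)
    {z z' : Fin m → ℂ} {s : ℝ} (hs : 0 ≤ s) (hzs : ∀ j, (z j).re = s) (hz's : ∀ j, (z' j).re = s) :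
    ‖eulerFactor q W (corrL m) e z z'‖ ≤ 1 + 3 * m * (q : ℝ) ^ (-(1 + s)) + 4 ^ m / q := by
  have hq : q.Prime := Fact.out
  have hz : ∀ j, 0 ≤ (z j).re := fun j => by rw [hzs j]; exact hs
  have hz' : ∀ j, 0 ≤ (z' j).re := fun j => by rw [hz's j]; exact hs
  calc ‖eulerFactor q W (corrL m) e z z'‖
      = ‖eulerMain q z z' + (eulerFactor q W (corrL m) e z z' - eulerMain q z z')‖ := by ring_nf
    _ ≤ ‖eulerMain q z z'‖ + ‖eulerFactor q W (corrL m) e z z' - eulerMain q z z'‖ := norm_add_le _ _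
    _ ≤ (1 + 3 * m * (q : ℝ) ^ (-(1 + s))) + 4 ^ m / q :=
        add_le_add (norm_eulerMain_le hq hs hzs hz's) (norm_corrEulerFactor_sub_main_le' hqW e hz hz')


/-! ### The correction sequence `δ'` of the correlation system: bounds and summability -/

section Delta

/-- The ordered pairs `i < i'` of indices. [folklore] -/
def pairs (m : ℕ) : Finset (Fin m × Fin m) := (univ : Finset (Fin m × Fin m)).filter fun p => p.1 < p.2

/-- `(i, i') ∈ pairs ↔ i < i'`. [folklore] -/
@[simp] theorem mem_pairs {p : Fin m × Fin m} : p ∈ pairs m ↔ p.1 < p.2 := by simp [pairs]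

/-- The exceptional modulus `E = ∏_{i<i'} |e_i - e_{i'}|`. [cite: GreenTao2010, App. D (Thm. D.3)] -/
def excModulus (e : Fin m → ℤ) : ℕ := ∏ p ∈ pairs m, (e p.1 - e p.2).natAbs

/-- `E ≠ 0` when the shifts are pairwise distinct. [folklore] -/
theorem excModulus_ne_zero {e : Fin m → ℤ} (he : Function.Injective e) : excModulus e ≠ 0 := by
  unfold excModulus
  refine prod_ne_zero_iff.2 fun p hp => ?_
  have hii' : p.1 ≠ p.2 := (mem_pairs.1 hp).ne
  exact Int.natAbs_ne_zero.2 (sub_ne_zero.2 fun h => hii' (he h))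

/-- A prime dividing some `e_i - e_{i'}` (`i ≠ i'`) divides `E`. [folklore] -/
theorem dvd_excModulus_of_not_generic {e : Fin m → ℤ} {q : ℕ} (hq : ¬ IsGenericPrime e q) : q ∣ excModulus e := by
  unfold IsGenericPrime at hq
  push Not at hq
  obtain ⟨i, i', hii', hdvd⟩ := hq
  have hnat : ∀ a b : Fin m, (q : ℤ) ∣ e a - e b → q ∣ (e a - e b).natAbs := fun a b h =>
    Int.natCast_dvd_natCast.1 (Int.dvd_natAbs.2 h)
  unfold excModulus
  rcases lt_or_gt_of_ne hii' with h | h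
  · exact (hnat i i' hdvd).trans (dvd_prod_of_mem (fun p : Fin m × Fin m => (e p.1 - e p.2).natAbs)
      (mem_pairs.2 (show (i, i').1 < (i, i').2 from h)))
  · have hdvd' : (q : ℤ) ∣ e i' - e i := by rw [← neg_sub]; exact hdvd.neg_right
    exact (hnat i' i hdvd').trans (dvd_prod_of_mem (fun p : Fin m × Fin m => (e p.1 - e p.2).natAbs)
      (mem_pairs.2 (show (i', i).1 < (i', i).2 from h)))

/-- The exceptional sum `X = ∑_{q > w prime, q ∣ E} 1/q`.
[cite: GreenTao2010, App. D (Thm. D.3: `X = ∑_{p ∈ P_Ψ} p^{-1/2}`)] -/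
def excSum (w : ℕ) (e : Fin m → ℤ) : ℝ := ∑ q ∈ roughPrimeFactors w (excModulus e), (1 : ℝ) / q

/-- `X ≥ 0`. [folklore] -/
theorem excSum_nonneg (w : ℕ) (e : Fin m → ℤ) : 0 ≤ excSum w e := sum_nonneg fun q _ => by positivity

/-- The two bookkeeping series: `1_{q > w} q^{-2}` and `1_{q exceptional} q^{-1}`. [folklore] -/
def deltaBound (w : ℕ) (e : Fin m → ℤ) (q : ℕ) : ℝ :=
  (if w < q then 1 / (q : ℝ) ^ 2 else 0) + (if q ∈ roughPrimeFactors w (excModulus e) then 1 / (q : ℝ) else 0)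

/-- `deltaBound ≥ 0`. [folklore] -/
theorem deltaBound_nonneg (w : ℕ) (e : Fin m → ℤ) (q : ℕ) : 0 ≤ deltaBound w e q := by
  unfold deltaBound; split_ifs <;> positivity

/-- `deltaBound` is summable. [folklore] -/
theorem summable_deltaBound (w : ℕ) (e : Fin m → ℤ) : Summable (deltaBound w e) := by
  classical
  have h1 : Summable fun q : ℕ => (if w < q then 1 / (q : ℝ) ^ 2 else 0) := by
    refine Summable.of_nonneg_of_le (fun q => ?_) (fun q => ?_) (Real.summable_one_div_nat_pow.2 one_lt_two)
    · split_ifs <;> positivity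
    · split_ifs <;> first | exact le_rfl | positivity
  have h2 : Summable fun q : ℕ => (if q ∈ roughPrimeFactors w (excModulus e) then 1 / (q : ℝ) else 0) :=
    summable_of_ne_finset_zero (s := roughPrimeFactors w (excModulus e)) fun q hq => if_neg hq
  exact h1.add h2

/-- `∑'_q deltaBound ≤ 1/w + X`. [folklore] -/
theorem tsum_deltaBound_le {w : ℕ} (hw : 1 ≤ w) (e : Fin m → ℤ) : ∑' q, deltaBound w e q ≤ 1 / (w : ℝ) + excSum w e := by
  classical
  have h1s : Summable fun q : ℕ => (if w < q then 1 / (q : ℝ) ^ 2 else 0) := by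
    refine Summable.of_nonneg_of_le (fun q => ?_) (fun q => ?_) (Real.summable_one_div_nat_pow.2 one_lt_two)
    · split_ifs <;> positivity
    · split_ifs <;> first | exact le_rfl | positivity
  have h2s : Summable fun q : ℕ => (if q ∈ roughPrimeFactors w (excModulus e) then 1 / (q : ℝ) else 0) :=
    summable_of_ne_finset_zero (s := roughPrimeFactors w (excModulus e)) fun q hq => if_neg hq
  have h1 : ∑' q : ℕ, (if w < q then 1 / (q : ℝ) ^ 2 else 0) ≤ 1 / (w : ℝ) :=
    h1s.tsum_le_of_sum_range_le fun N => sum_range_inv_sq_tail_le hw N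
  have h2 : ∑' q : ℕ, (if q ∈ roughPrimeFactors w (excModulus e) then 1 / (q : ℝ) else 0) = excSum w e := by
    rw [tsum_eq_sum (s := roughPrimeFactors w (excModulus e)) (fun q hq => if_neg hq)]
    exact sum_congr rfl fun q hq => if_pos hq
  unfold deltaBound
  rw [(h1s.hasSum.add h2s.hasSum).tsum_eq, h2]
  linarith

/-- **The size of `δ'_q` for the correlation system**: `0` unless `q > w` is prime, `≤ deltaConst/q²` at
a generic prime and `≤ deltaConst/q` at an exceptional one (`w ≥ 21m + 2`, shifts pairwise
distinct): `‖δ'_q‖ ≤ deltaConst · deltaBound(q)`.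
[cite: ConlonFoxZhao2014, Section 9] [cite: GreenTao2010, App. D (Thm. D.3)] -/
theorem norm_corr_deltaSeq_le {R : ℝ} (hR : 1 < R) {w : ℕ} (hw : 21 * m + 2 ≤ w) {e : Fin m → ℤ}
    (he : Function.Injective e) (η : Fin m ⊕ Fin m → ℝ) (q : ℕ) :
    ‖deltaSeq R (primorial w) (corrL m) e w η q‖ ≤ deltaConst m * deltaBound w e q := by
  classical
  have hlogR : 0 < Real.log R := Real.log_pos hR
  have hzre : ∀ j, 0 ≤ (zL R η j).re := fun j => by simp only [zL, zOf_re]; positivity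
  have hz're : ∀ j, 0 ≤ (zR R η j).re := fun j => by simp only [zR, zOf_re]; positivity
  have hdc := deltaConst_nonneg m
  have hdb := deltaBound_nonneg w e q
  unfold deltaSeq
  split_ifs with h
  · obtain ⟨hq, hwq⟩ := h
    haveI : Fact q.Prime := ⟨hq⟩
    have hqW : ¬ q ∣ primorial w := fun hd => by have := (hq.dvd_primorial_iff).1 hd; omega
    have hgt : deltaConst m * (1 / (q : ℝ) ^ 2) ≤ deltaConst m * deltaBound w e q := by
      refine mul_le_mul_of_nonneg_left ?_ hdc
      unfold deltaBound
      rw [if_pos hwq]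
      split_ifs <;> [exact le_add_of_nonneg_right (by positivity); exact le_rfl.trans (le_add_of_nonneg_right le_rfl)]
    by_cases hgen : IsGenericPrime e q
    · refine (norm_corr_delta_le_generic hqW (by omega) hgen hzre hz're).2.trans ?_
      rw [← mul_one_div]
      exact hgt
    · refine (norm_corr_delta_le_exceptional hqW (by omega) e hzre hz're).2.trans ?_
      have hmem : q ∈ roughPrimeFactors w (excModulus e) :=
        Finset.mem_filter.2 ⟨Nat.mem_primeFactors.2 ⟨hq, dvd_excModulus_of_not_generic hgen, excModulus_ne_zero he⟩, hwq⟩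
      rw [← mul_one_div]
      refine mul_le_mul_of_nonneg_left ?_ hdc
      unfold deltaBound
      rw [if_pos hwq, if_pos hmem]
      exact le_add_of_nonneg_left (by positivity)
  · rw [norm_zero]; positivity

/-- **`δ'` is absolutely summable.** [cite: ConlonFoxZhao2014, Section 9] -/
theorem summable_norm_corr_deltaSeq {R : ℝ} (hR : 1 < R) {w : ℕ} (hw : 21 * m + 2 ≤ w) {e : Fin m → ℤ}
    (he : Function.Injective e) (η : Fin m ⊕ Fin m → ℝ) :
    Summable fun q => ‖deltaSeq R (primorial w) (corrL m) e w η q‖ :=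
  Summable.of_nonneg_of_le (fun _ => norm_nonneg _) (norm_corr_deltaSeq_le hR hw he η)
    ((summable_deltaBound w e).mul_left _)

/-- **`∑'_q ‖δ'_q‖ ≤ deltaConst · (1/w + X)`.** [cite: GreenTao2010, App. D (Thm. D.3: the factor `e^{O(X)}`)] -/
theorem tsum_norm_corr_deltaSeq_le {R : ℝ} (hR : 1 < R) {w : ℕ} (hw : 21 * m + 2 ≤ w) {e : Fin m → ℤ}
    (he : Function.Injective e) (η : Fin m ⊕ Fin m → ℝ) :
    ∑' q, ‖deltaSeq R (primorial w) (corrL m) e w η q‖ ≤ deltaConst m * (1 / (w : ℝ) + excSum w e) := by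
  have hw1 : 1 ≤ w := by omega
  calc ∑' q, ‖deltaSeq R (primorial w) (corrL m) e w η q‖
      ≤ ∑' q, deltaConst m * deltaBound w e q :=
        (summable_norm_corr_deltaSeq hR hw he η).tsum_le_tsum (norm_corr_deltaSeq_le hR hw he η)
          ((summable_deltaBound w e).mul_left _)
    _ = deltaConst m * ∑' q, deltaBound w e q := tsum_mul_left
    _ ≤ deltaConst m * (1 / (w : ℝ) + excSum w e) :=
        mul_le_mul_of_nonneg_left (tsum_deltaBound_le hw1 e) (deltaConst_nonneg m)

/-! ### The dominator and the exact integral representation -/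

/-- `1 + x ≤ (1 - x)⁻¹` for `0 ≤ x < 1`. [folklore] -/
theorem one_add_le_inv_one_sub {x : ℝ} (h0 : 0 ≤ x) (h1 : x < 1) : 1 + x ≤ (1 - x)⁻¹ := by
  rw [le_inv_comm₀ (by linarith) (by linarith), inv_eq_one_div, le_div_iff₀ (by linarith)]
  nlinarith

/-- **`|E'_p(z,z')| ≤ (1 - p^{-(1+s)})^{-3m}`** for `Re z_j = Re z'_j = s ≥ 0`, `p ≥ 2`: each factor
`(1-a)(1-b)/(1-c)` has `|a|, |b|, |c| ≤ p^{-(1+s)} = x` and `1 + x ≤ (1-x)^{-1}`, `|1 - c| ≥ 1 - x`.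
[cite: ConlonFoxZhao2014, Section 9, Estimate (32)] -/
theorem norm_eulerFactor'_le {p : ℕ} (hp : 2 ≤ p) {z z' : Fin m → ℂ} {s : ℝ} (hs : 0 ≤ s)
    (hzs : ∀ j, (z j).re = s) (hz's : ∀ j, (z' j).re = s) :
    ‖eulerFactor' p z z'‖ ≤ ((1 - (p : ℝ) ^ (-(1 + s)))⁻¹) ^ (3 * m) := by
  have hp0 : 0 < p := by omega
  have hp1 : (1 : ℝ) < p := by exact_mod_cast (by omega : 1 < p)
  set x : ℝ := (p : ℝ) ^ (-(1 + s)) with hx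
  have hx0 : 0 < x := Real.rpow_pos_of_pos (by linarith) _
  have hx1 : x < 1 := Real.rpow_lt_one_of_one_lt_of_neg hp1 (by linarith)
  have hnorm : ∀ w : ℂ, s ≤ w.re → ‖(p : ℂ) ^ (-(1 + w))‖ ≤ x := fun w hw => by
    rw [Complex.norm_natCast_cpow_of_pos hp0, hx]
    refine Real.rpow_le_rpow_of_exponent_le hp1.le ?_
    simp only [Complex.neg_re, Complex.add_re, Complex.one_re]
    linarith
  have hinv := one_add_le_inv_one_sub hx0.le hx1
  have hI0 : 0 < (1 - x)⁻¹ := inv_pos.2 (by linarith)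
  -- one factor
  have hfac : ∀ j, ‖(1 - (p : ℂ) ^ (-(1 + z j))) * (1 - (p : ℂ) ^ (-(1 + z' j))) / (1 - (p : ℂ) ^ (-(1 + z j + z' j)))‖ ≤
      ((1 - x)⁻¹) ^ 3 := by
    intro j
    have ha : ‖(p : ℂ) ^ (-(1 + z j))‖ ≤ x := hnorm _ (by rw [hzs j])
    have hb : ‖(p : ℂ) ^ (-(1 + z' j))‖ ≤ x := hnorm _ (by rw [hz's j])
    have hc : ‖(p : ℂ) ^ (-(1 + z j + z' j))‖ ≤ x := by
      have := hnorm (z j + z' j) (by rw [Complex.add_re, hzs, hz's]; linarith)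
      rwa [← add_assoc] at this
    have h1a : ‖1 - (p : ℂ) ^ (-(1 + z j))‖ ≤ (1 - x)⁻¹ :=
      ((norm_sub_le _ _).trans (by rw [norm_one]; linarith)).trans hinv
    have h1b : ‖1 - (p : ℂ) ^ (-(1 + z' j))‖ ≤ (1 - x)⁻¹ :=
      ((norm_sub_le _ _).trans (by rw [norm_one]; linarith)).trans hinv
    have h1c : 1 - x ≤ ‖1 - (p : ℂ) ^ (-(1 + z j + z' j))‖ := by
      have := norm_sub_norm_le (1 : ℂ) ((p : ℂ) ^ (-(1 + z j + z' j)))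
      rw [norm_one] at this
      linarith
    have hcpos : 0 < ‖1 - (p : ℂ) ^ (-(1 + z j + z' j))‖ := lt_of_lt_of_le (by linarith) h1c
    rw [norm_div, norm_mul, div_le_iff₀ hcpos]
    calc ‖1 - (p : ℂ) ^ (-(1 + z j))‖ * ‖1 - (p : ℂ) ^ (-(1 + z' j))‖
        ≤ (1 - x)⁻¹ * (1 - x)⁻¹ := mul_le_mul h1a h1b (norm_nonneg _) hI0.le
      _ = ((1 - x)⁻¹) ^ 3 * (1 - x) := by field_simp
      _ ≤ ((1 - x)⁻¹) ^ 3 * ‖1 - (p : ℂ) ^ (-(1 + z j + z' j))‖ := mul_le_mul_of_nonneg_left h1c (by positivity)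
  unfold eulerFactor'
  calc ‖∏ j, (1 - (p : ℂ) ^ (-(1 + z j))) * (1 - (p : ℂ) ^ (-(1 + z' j))) / (1 - (p : ℂ) ^ (-(1 + z j + z' j)))‖
      ≤ ∏ j, ‖(1 - (p : ℂ) ^ (-(1 + z j))) * (1 - (p : ℂ) ^ (-(1 + z' j))) / (1 - (p : ℂ) ^ (-(1 + z j + z' j)))‖ :=
        Finset.norm_prod_le _ _
    _ ≤ ∏ _j : Fin m, ((1 - x)⁻¹) ^ 3 := prod_le_prod (fun j _ => norm_nonneg _) fun j _ => hfac j
    _ = ((1 - x)⁻¹) ^ (3 * m) := by rw [prod_const, card_univ, Fintype.card_fin, ← pow_mul, mul_comm]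

/-- **The dominator for the correlation system**: all partial Euler products are bounded, uniformly in
`Q` and `η`, by `(log R + C)^{3m} · exp(deltaConst (1/w + X))`: for `p ≤ w`, `E_p = 1`; for `p > w`,
`E_p = E'_p (1 + δ'_p)` with `∏ |E'_p| ≤ |ζ(1 + 1/log R)|^{3m}` and `∏ (1 + |δ'_p|) ≤ e^{∑ |δ'|}`.
[cite: ConlonFoxZhao2014, Section 9, Estimate (32)] [cite: GreenTao2010, App. D (Thm. D.3)] -/
theorem exists_corr_dominator : ∃ C : ℝ, 0 ≤ C ∧ ∀ (m : ℕ) (R : ℝ), 0 < R → 1 ≤ Real.log R →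
    ∀ (w : ℕ), 21 * m + 2 ≤ w → ∀ (e : Fin m → ℤ), Function.Injective e → ∀ (Q : ℕ) (η : Fin m ⊕ Fin m → ℝ),
      ‖∏ p ∈ Q.primesBelow, eulerFactor p (primorial w) (corrL m) e (zL R η) (zR R η)‖ ≤
        (Real.log R + C) ^ (3 * m) * Real.exp (deltaConst m * (1 / (w : ℝ) + excSum w e)) := by
  classical
  obtain ⟨C, hC0, hC⟩ := exists_norm_zeta_real_le
  refine ⟨C, hC0, fun m R hR0 hR w hw e he Q η => ?_⟩
  have hlogR : 0 < Real.log R := by linarith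
  have hR1 : 1 < R := by
    by_contra h
    have := Real.log_nonpos hR0.le (not_lt.1 h); linarith
  set s : ℝ := 1 / Real.log R with hs_def
  have hs0 : 0 < s := by positivity
  have hs1 : s ≤ 1 := by rw [hs_def, div_le_one hlogR]; exact hR
  have hzs : ∀ j, (zL R η j).re = s := fun j => by simp only [zL, zOf_re, hs_def]
  have hz's : ∀ j, (zR R η j).re = s := fun j => by simp only [zR, zOf_re, hs_def]
  have hz : ∀ j, 0 ≤ (zL R η j).re := fun j => by rw [hzs j]; exact hs0.le
  have hz' : ∀ j, 0 ≤ (zR R η j).re := fun j => by rw [hz's j]; exact hs0.le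
  set g : ℕ → ℝ := fun p => ((1 - (p : ℝ) ^ (-(1 + s)))⁻¹) ^ (3 * m) with hg_def
  set δ : ℕ → ℂ := deltaSeq R (primorial w) (corrL m) e w η with hδ_def
  have hfacpos : ∀ p : ℕ, p.Prime → 0 < (p : ℝ) ^ (-(1 + s)) ∧ (p : ℝ) ^ (-(1 + s)) < 1 := fun p hp => by
    have hp1 : (1 : ℝ) < p := by exact_mod_cast hp.one_lt
    exact ⟨Real.rpow_pos_of_pos (by linarith) _, Real.rpow_lt_one_of_one_lt_of_neg hp1 (by linarith)⟩
  have hg1 : ∀ p : ℕ, p.Prime → 1 ≤ g p := fun p hp => by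
    obtain ⟨h0, h1⟩ := hfacpos p hp
    refine one_le_pow₀ ?_
    rw [le_inv_comm₀ zero_lt_one (by linarith), inv_one]; linarith
  -- termwise
  have hEp : ∀ p ∈ Q.primesBelow, ‖eulerFactor p (primorial w) (corrL m) e (zL R η) (zR R η)‖ ≤ g p * (1 + ‖δ p‖) := by
    intro p hp
    have hpp := (Nat.mem_primesBelow.1 hp).2
    haveI : Fact p.Prime := ⟨hpp⟩
    have hg1p := hg1 p hpp
    by_cases hpw : p ≤ w
    · rw [eulerFactor_eq_one_of_dvd ((hpp.dvd_primorial_iff).2 hpw) (corrL m) e _ _, norm_one]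
      calc (1 : ℝ) = 1 * 1 := (mul_one _).symm
        _ ≤ g p * (1 + ‖δ p‖) := mul_le_mul hg1p (le_add_of_nonneg_right (norm_nonneg _)) zero_le_one (by linarith)
    · have hwp : w < p := not_le.1 hpw
      have hne : eulerFactor' p (zL R η) (zR R η) ≠ 0 := eulerFactor'_ne_zero hpp.two_le hz hz'
      have hδp : δ p = eulerFactor p (primorial w) (corrL m) e (zL R η) (zR R η) / eulerFactor' p (zL R η) (zR R η) - 1 := by
        simp only [hδ_def, deltaSeq, if_pos (And.intro hpp hwp)]
      have hE : eulerFactor p (primorial w) (corrL m) e (zL R η) (zR R η) =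
          eulerFactor' p (zL R η) (zR R η) * (1 + δ p) := by
        rw [hδp]; field_simp; ring
      rw [hE, norm_mul]
      refine mul_le_mul (norm_eulerFactor'_le hpp.two_le hs0.le hzs hz's) ?_ (norm_nonneg _) (by linarith)
      exact (norm_add_le _ _).trans (by rw [norm_one])
  -- the two products
  have hprod_g : ∏ p ∈ Q.primesBelow, g p ≤ (Real.log R + C) ^ (3 * m) := by
    rw [hg_def, prod_pow]
    refine pow_le_pow_left₀ (prod_nonneg fun p hp => ?_) ?_ _
    · exact inv_nonneg.2 (by linarith [(hfacpos p (Nat.mem_primesBelow.1 hp).2).2])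
    · have h1 : (1 : ℝ) < 1 + s := by linarith
      have h2 : 1 + s ≤ 2 := by linarith
      calc ∏ p ∈ Q.primesBelow, (1 - (p : ℝ) ^ (-(1 + s)))⁻¹ ≤ ‖riemannZeta (1 + s : ℝ)‖ := by
            have := prod_primesBelow_le_norm_zeta h1 Q
            exact_mod_cast this
        _ ≤ 1 / (1 + s - 1) + C := hC (1 + s) h1 h2
        _ = Real.log R + C := by rw [add_sub_cancel_left, hs_def, one_div_one_div]
  have hprod_δ : ∏ p ∈ Q.primesBelow, (1 + ‖δ p‖) ≤ Real.exp (deltaConst m * (1 / (w : ℝ) + excSum w e)) := by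
    calc ∏ p ∈ Q.primesBelow, (1 + ‖δ p‖) ≤ ∏ p ∈ Q.primesBelow, Real.exp ‖δ p‖ :=
          prod_le_prod (fun p _ => by positivity) fun p _ => by have := Real.add_one_le_exp ‖δ p‖; linarith
      _ = Real.exp (∑ p ∈ Q.primesBelow, ‖δ p‖) := (Real.exp_sum _ _).symm
      _ ≤ Real.exp (∑' p, ‖δ p‖) := Real.exp_le_exp.2
          ((summable_norm_corr_deltaSeq hR1 hw he η).sum_le_tsum _ fun p _ => norm_nonneg _)
      _ ≤ Real.exp (deltaConst m * (1 / (w : ℝ) + excSum w e)) := Real.exp_le_exp.2 (tsum_norm_corr_deltaSeq_le hR1 hw he η)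
  calc ‖∏ p ∈ Q.primesBelow, eulerFactor p (primorial w) (corrL m) e (zL R η) (zR R η)‖
      ≤ ∏ p ∈ Q.primesBelow, ‖eulerFactor p (primorial w) (corrL m) e (zL R η) (zR R η)‖ := norm_prod_le _ _
    _ ≤ ∏ p ∈ Q.primesBelow, (g p * (1 + ‖δ p‖)) := prod_le_prod (fun p _ => norm_nonneg _) hEp
    _ = (∏ p ∈ Q.primesBelow, g p) * ∏ p ∈ Q.primesBelow, (1 + ‖δ p‖) := prod_mul_distrib
    _ ≤ (Real.log R + C) ^ (3 * m) * Real.exp (deltaConst m * (1 / (w : ℝ) + excSum w e)) :=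
        mul_le_mul hprod_g hprod_δ (prod_nonneg fun p _ => by positivity) (by positivity)

/-- The limit `Lim(η)` of the partial Euler products of the correlation system.
[cite: ConlonFoxZhao2014, Section 9, equations (33)–(35)] -/
def corrLim (R : ℝ) (w : ℕ) (e : Fin m → ℤ) (η : Fin m ⊕ Fin m → ℝ) : ℂ :=
  zetaRatio R η / (∏ p ∈ (w + 1).primesBelow, eulerFactor' p (zL R η) (zR R η)) *
    ∏' q, (1 + deltaSeq R (primorial w) (corrL m) e w η q)

/-- `∏_{p<Q} E_p(z(η)) → Lim(η)` for the correlation system. [cite: ConlonFoxZhao2014, Section 9, equations (33)–(35)] -/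
theorem tendsto_corrLim {R : ℝ} (hR : 1 < R) {w : ℕ} (hw : 21 * m + 2 ≤ w) {e : Fin m → ℤ}
    (he : Function.Injective e) (η : Fin m ⊕ Fin m → ℝ) :
    Tendsto (fun Q : ℕ => ∏ p ∈ Q.primesBelow, eulerFactor p (primorial w) (corrL m) e (zL R η) (zR R η)) atTop
      (𝓝 (corrLim R w e η)) :=
  tendsto_prod_eulerFactor R (primorial w) (corrL m) e w η hR (prime_dvd_primorial_iff' w)
    (summable_norm_corr_deltaSeq hR hw he η)
where
  /-- `p ∣ W ↔ p ≤ w` for primes `p`. [folklore] -/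
  prime_dvd_primorial_iff' (w : ℕ) : ∀ p : ℕ, p.Prime → (p ∣ primorial w ↔ p ≤ w) := fun _ hp => hp.dvd_primorial_iff

variable {χ : ℝ → ℝ}

/-- **The tuple sum of the correlation system is `∫ Φ · Lim` exactly** (as in the tree's
`CFZ.Setup.trueSumC_eq_integral`, with the dominator and the limit of this file).
[cite: ConlonFoxZhao2014, Section 9, equations (29), (32)–(35)] -/
theorem corr_trueSumC_eq_integral (hs : ContDiff ℝ (⊤ : ℕ∞) χ) (hsupp : ∀ x, 1 ≤ |x| → χ x = 0)
    {R : ℝ} (hR0 : 0 < R) (hR : 1 ≤ Real.log R) {w : ℕ} (hw : 21 * m + 2 ≤ w) {e : Fin m → ℤ}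
    (he : Function.Injective e) :
    trueSumC χ R (primorial w) (corrL m) e =
      ∫ η, (∏ v, phiF χ (η v)) * corrLim R w e η ∂(fullMeasure m) := by
  have hlogR : 0 < Real.log R := by linarith
  have hR1 : 1 < R := by
    by_contra h
    have := Real.log_nonpos hR0.le (not_lt.1 h); linarith
  obtain ⟨C, -, hB⟩ := exists_corr_dominator
  have hBound := hB m R hR0 hR w hw e he
  have hconst : ∀ᶠ Q : ℕ in atTop,
      trueSumC χ R (primorial w) (corrL m) e = ∫ η, (∏ v, phiF χ (η v)) *
        ∏ p ∈ Q.primesBelow, eulerFactor p (primorial w) (corrL m) e (zL R η) (zR R η) ∂(fullMeasure m) := by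
    filter_upwards [eventually_gt_atTop ⌊R⌋₊] with Q hQ
    rw [← sum_coef_prod_chi_eq_integral hs hsupp hR1 (fun p hp => (Nat.mem_primesBelow.1 hp).2)]
    exact sum_piFinset_eq_of_vanish _ _ _ fun dd hdd => tupleSummand_eq_zero hsupp hR1 _ (corrL m) e hQ dd hdd
  have hlim : ∀ η : Fin m ⊕ Fin m → ℝ, ∃ l : ℂ, Tendsto
      (fun Q : ℕ => ∏ p ∈ Q.primesBelow, eulerFactor p (primorial w) (corrL m) e (zL R η) (zR R η)) atTop (𝓝 l) :=
    fun η => ⟨_, tendsto_corrLim hR1 hw he η⟩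
  have h1 := tendsto_integral_prod_eulerFactor_full hs hsupp R (primorial w) (corrL m) e hBound hlim
  have h2 : Tendsto (fun Q : ℕ => ∫ η, (∏ v, phiF χ (η v)) *
      ∏ p ∈ Q.primesBelow, eulerFactor p (primorial w) (corrL m) e (zL R η) (zR R η) ∂(fullMeasure m)) atTop
      (𝓝 (trueSumC χ R (primorial w) (corrL m) e)) :=
    tendsto_const_nhds.congr' (hconst.mono fun Q hQ => hQ)
  rw [tendsto_nhds_unique h2 h1]
  refine integral_congr_ae (Eventually.of_forall fun η => ?_)
  show (∏ v, phiF χ (η v)) * (hlim η).choose = (∏ v, phiF χ (η v)) * corrLim R w e η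
  rw [tendsto_nhds_unique (hlim η).choose_spec (tendsto_corrLim hR1 hw he η)]

end Delta


/-! ### The upper bound for the tuple sum of the correlation system -/

section Integral

variable {χ : ℝ → ℝ}

/-- `‖Lim(η)‖ ≤ B` for any uniform bound `B` of the partial products. [cite: ConlonFoxZhao2014, Section 9] -/
theorem norm_corrLim_le {R : ℝ} (hR : 1 < R) {w : ℕ} (hw : 21 * m + 2 ≤ w) {e : Fin m → ℤ}
    (he : Function.Injective e) {B : ℝ}
    (hB : ∀ (Q : ℕ) (η : Fin m ⊕ Fin m → ℝ),
      ‖∏ p ∈ Q.primesBelow, eulerFactor p (primorial w) (corrL m) e (zL R η) (zR R η)‖ ≤ B)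
    (η : Fin m ⊕ Fin m → ℝ) : ‖corrLim R w e η‖ ≤ B :=
  le_of_tendsto (tendsto_corrLim hR hw he η).norm (Eventually.of_forall fun Q => hB Q η)

/-- The relative error of the correlation main term on the box:
`(1+α)(1+2β) e^{deltaConst(1/w + X)} - 1`. [cite: ConlonFoxZhao2014, Section 9] -/
def corrErr (K₀ δ : ℝ) (m w : ℕ) (X : ℝ) : ℝ :=
  (1 + alphaErr K₀ δ m) * (1 + 2 * betaErr δ m w) * Real.exp (deltaConst m * (1 / (w : ℝ) + X)) - 1

/-- `corrErr ≥ 0`. [folklore] -/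
theorem corrErr_nonneg {K₀ δ : ℝ} (hK : 0 ≤ K₀) (hδ : 0 ≤ δ) (m w : ℕ) {X : ℝ} (hX : 0 ≤ X) : 0 ≤ corrErr K₀ δ m w X := by
  unfold corrErr
  have ha := alphaErr_nonneg hK hδ m
  have hb := betaErr_nonneg hδ m w
  have hc : 1 ≤ Real.exp (deltaConst m * (1 / (w : ℝ) + X)) :=
    Real.one_le_exp (mul_nonneg (deltaConst_nonneg m) (by positivity))
  have h1 : (1 : ℝ) * 1 * 1 ≤ (1 + alphaErr K₀ δ m) * (1 + 2 * betaErr δ m w) * Real.exp (deltaConst m * (1 / (w : ℝ) + X)) :=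
    mul_le_mul (mul_le_mul (by linarith) (by linarith) zero_le_one (by linarith)) hc zero_le_one (by positivity)
  linarith

/-- **The tuple sum of the correlation system is bounded**:
`‖trueSum‖ ≤ (1 + Err) (W/φ(W))^m (2 log R)^{-m} M₂^{2m} + B · tailBox(T)` with
`Err = (1+α)(1+2β) e^{deltaConst(1/w + X)} - 1` — the pointwise comparison of the tree on the box
(`CFZ.norm_limit_sub_main_le`, with the correction product bounded by `e^{∑‖δ'‖}` instead of being
close to `1`), and the dominator `B` off the box. [cite: ConlonFoxZhao2014, Section 9, equations (33)–(37)]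
[cite: GreenTao2010, App. D (Thm. D.3)] -/
theorem norm_corr_trueSumC_le (hs : ContDiff ℝ (⊤ : ℕ∞) χ) (hsupp : ∀ x, 1 ≤ |x| → χ x = 0)
    {R : ℝ} (hR0 : 0 < R) (hR : 1 ≤ Real.log R) {w : ℕ} (hw : 21 * m + 2 ≤ w) {e : Fin m → ℤ}
    (he : Function.Injective e) {T δ₀ K₀ : ℝ} (hT : 0 ≤ T) (hK₀ : 0 ≤ K₀)
    (hζ : ∀ z z' : ℂ, z ≠ 0 → z' ≠ 0 → z + z' ≠ 0 → ∀ δ : ℝ, δ ≤ δ₀ → ‖z‖ ≤ δ → ‖z'‖ ≤ δ →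
      ‖riemannZeta (1 + z + z') / (riemannZeta (1 + z) * riemannZeta (1 + z')) - z * z' / (z + z')‖ ≤
        K₀ * δ * ‖z * z' / (z + z')‖)
    (hδ₀ : deltaOf R T ≤ δ₀) (hδw : 2 * deltaOf R T * Real.log w ≤ 1 / 8)
    (hβ : betaErr (deltaOf R T) m w ≤ 1 / 2) {B : ℝ}
    (hB : ∀ (Q : ℕ) (η : Fin m ⊕ Fin m → ℝ),
      ‖∏ p ∈ Q.primesBelow, eulerFactor p (primorial w) (corrL m) e (zL R η) (zR R η)‖ ≤ B) :
    ‖trueSumC χ R (primorial w) (corrL m) e‖ ≤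
      (1 + corrErr K₀ (deltaOf R T) m w (excSum w e)) * cW w m * ((2 * Real.log R) ^ m)⁻¹ * (∫ x, phiWeight χ x) ^ (2 * m) +
        B * tailBox χ m T := by
  have hlogR : 0 < Real.log R := by linarith
  have hR1 : 1 < R := by
    by_contra h
    have := Real.log_nonpos hR0.le (not_lt.1 h); linarith
  rw [corr_trueSumC_eq_integral hs hsupp hR0 hR hw he]
  set Φ : (Fin m ⊕ Fin m → ℝ) → ℂ := fun η => ∏ v, phiF χ (η v) with hΦ_def
  set Lim : (Fin m ⊕ Fin m → ℝ) → ℂ := corrLim R w e with hLim_def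
  set c : ℝ := cW w m with hc_def
  set κ : ℝ := ((2 * Real.log R) ^ m)⁻¹ with hκ_def
  set E : ℝ := corrErr K₀ (deltaOf R T) m w (excSum w e) with hE_def
  have hc0 : 0 ≤ c := (cW_pos w m).le
  have hκ0 : 0 ≤ κ := by positivity
  have hB0 : 0 ≤ B := (norm_nonneg _).trans (hB 0 0)
  have hδ0 : 0 ≤ deltaOf R T := deltaOf_nonneg hT hlogR
  have hE0 : 0 ≤ E := corrErr_nonneg hK₀ hδ0 m w (excSum_nonneg w e)
  have hGi : Integrable (prodWeight χ) (fullMeasure m) := integrable_prodWeight hs hsupp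
  -- the correction product is within `γ'` of `1`
  have hP : ∀ η, ‖(∏' q, (1 + deltaSeq R (primorial w) (corrL m) e w η q)) - 1‖ ≤
      Real.exp (deltaConst m * (1 / (w : ℝ) + excSum w e)) - 1 := fun η =>
    (norm_tprod_one_add_sub_one_le _ (summable_norm_corr_deltaSeq hR1 hw he η)).trans
      (sub_le_sub_right (Real.exp_le_exp.2 (tsum_norm_corr_deltaSeq_le hR1 hw he η)) _)
  -- the pointwise bound
  have hpt : ∀ η, ‖Φ η * Lim η‖ ≤ (1 + E) * c * κ * prodWeight χ η + B * (box m T)ᶜ.indicator (prodWeight χ) η := by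
    intro η
    rw [norm_mul]
    have hG0 : 0 ≤ prodWeight χ η := prodWeight_nonneg χ η
    have h1 : ‖Φ η‖ ≤ prodWeight χ η := norm_prod_phiF_le_prodWeight χ η
    have h2 : ‖Φ η‖ * ‖mainZ R η‖ ≤ κ * prodWeight χ η := norm_prod_phiF_mul_norm_mainZ_le χ hR1 η
    by_cases hη : η ∈ box m T
    · have hηT : ∀ v, |η v| ≤ T := hη
      have hpw : ‖Lim η - mainZ R η * (c : ℂ)‖ ≤ E * (‖mainZ R η‖ * c) := by
        have h := norm_limit_sub_main_le hζ hR1 hT hδ₀ hδw hβ η hηT _ (hP η)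
        rw [hE_def]
        unfold corrErr alphaErr betaErr
        rw [show (1 : ℝ) + (Real.exp (deltaConst m * (1 / (w : ℝ) + excSum w e)) - 1) =
          Real.exp (deltaConst m * (1 / (w : ℝ) + excSum w e)) by ring] at h
        exact h
      have hLim : ‖Lim η‖ ≤ (1 + E) * (‖mainZ R η‖ * c) := by
        have h3 : ‖mainZ R η * (c : ℂ)‖ = ‖mainZ R η‖ * c := by
          rw [norm_mul, Complex.norm_real, Real.norm_eq_abs, abs_of_nonneg hc0]
        calc ‖Lim η‖ = ‖(Lim η - mainZ R η * (c : ℂ)) + mainZ R η * (c : ℂ)‖ := by rw [sub_add_cancel]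
          _ ≤ ‖Lim η - mainZ R η * (c : ℂ)‖ + ‖mainZ R η * (c : ℂ)‖ := norm_add_le _ _
          _ ≤ E * (‖mainZ R η‖ * c) + ‖mainZ R η‖ * c := by rw [h3]; exact add_le_add hpw le_rfl
          _ = (1 + E) * (‖mainZ R η‖ * c) := by ring
      rw [Set.indicator_of_notMem (by rw [Set.mem_compl_iff, not_not]; exact hη), mul_zero, add_zero]
      calc ‖Φ η‖ * ‖Lim η‖ ≤ ‖Φ η‖ * ((1 + E) * (‖mainZ R η‖ * c)) := mul_le_mul_of_nonneg_left hLim (norm_nonneg _)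
        _ = (1 + E) * c * (‖Φ η‖ * ‖mainZ R η‖) := by ring
        _ ≤ (1 + E) * c * (κ * prodWeight χ η) := mul_le_mul_of_nonneg_left h2 (by positivity)
        _ = (1 + E) * c * κ * prodWeight χ η := by ring
    · rw [Set.indicator_of_mem (Set.mem_compl hη)]
      calc ‖Φ η‖ * ‖Lim η‖ ≤ prodWeight χ η * B :=
            mul_le_mul h1 (norm_corrLim_le hR1 hw he hB η) (norm_nonneg _) hG0
        _ = B * prodWeight χ η := by ring
        _ ≤ (1 + E) * c * κ * prodWeight χ η + B * prodWeight χ η := le_add_of_nonneg_left (by positivity)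
  have hbound_int : Integrable (fun η => (1 + E) * c * κ * prodWeight χ η + B * (box m T)ᶜ.indicator (prodWeight χ) η)
      (fullMeasure m) :=
    (hGi.const_mul _).add ((hGi.indicator (measurableSet_box m T).compl).const_mul _)
  calc ‖∫ η, Φ η * Lim η ∂(fullMeasure m)‖
      ≤ ∫ η, ((1 + E) * c * κ * prodWeight χ η + B * (box m T)ᶜ.indicator (prodWeight χ) η) ∂(fullMeasure m) :=
        norm_integral_le_of_norm_le hbound_int (Eventually.of_forall hpt)
    _ = (1 + E) * c * κ * (∫ η, prodWeight χ η ∂(fullMeasure m)) + B * tailBox χ m T := by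
        rw [integral_add (hGi.const_mul _) ((hGi.indicator (measurableSet_box m T).compl).const_mul _),
          integral_const_mul, integral_const_mul]
        rfl
    _ = (1 + E) * c * κ * (∫ x, phiWeight χ x) ^ (2 * m) + B * tailBox χ m T := by rw [integral_prodWeight χ]

end Integral


/-! ### Bookkeeping for the exceptional sum -/

section ExcSum

/-- A union bound: if every element of `U` lies in some `A k`, `k ∈ P`, then for `g ≥ 0`
`∑_{q ∈ U} g q ≤ ∑_{k ∈ P} ∑_{q ∈ A k} g q`. [folklore] -/
theorem sum_le_sum_sum_of_cover {α β : Type*} [DecidableEq α] [DecidableEq β] {U : Finset α} {P : Finset β}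
    {A : β → Finset α} (h : ∀ q ∈ U, ∃ k ∈ P, q ∈ A k) {g : α → ℝ} (hg : ∀ q, 0 ≤ g q) :
    ∑ q ∈ U, g q ≤ ∑ k ∈ P, ∑ q ∈ A k, g q := by
  calc ∑ q ∈ U, g q ≤ ∑ q ∈ U, ∑ k ∈ P.filter (fun k => q ∈ A k), g q := by
        refine sum_le_sum fun q hq => ?_
        rw [sum_const, nsmul_eq_mul]
        obtain ⟨k, hk, hqk⟩ := h q hq
        have : 1 ≤ (#(P.filter fun k => q ∈ A k) : ℝ) := by
          exact_mod_cast card_pos.2 ⟨k, mem_filter.2 ⟨hk, hqk⟩⟩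
        nlinarith [hg q]
    _ = ∑ k ∈ P, ∑ q ∈ U.filter (fun q => q ∈ A k), g q :=
        Finset.sum_comm' fun q k => by simp only [mem_filter]; tauto
    _ ≤ ∑ k ∈ P, ∑ q ∈ A k, g q :=
        sum_le_sum fun k _ => sum_le_sum_of_subset_of_nonneg (fun q hq => (mem_filter.1 hq).2) fun q _ _ => hg q

/-- **The exceptional sum is at most the sum over pairs**: `X ≤ ∑_{i<i'} ∑_{q > w, q ∣ e_i - e_{i'}} 1/q`.
[cite: GreenTao2010, App. D (Thm. D.3)] -/
theorem excSum_le_sum_pairs (w : ℕ) {e : Fin m → ℤ} (he : Function.Injective e) :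
    excSum w e ≤ ∑ p ∈ pairs m, ∑ q ∈ roughPrimeFactors w (e p.1 - e p.2).natAbs, (1 : ℝ) / q := by
  classical
  unfold excSum
  refine sum_le_sum_sum_of_cover (fun q hq => ?_) (fun q => by positivity)
  have hq' := Finset.mem_filter.1 hq
  have hqp := Nat.mem_primeFactors.1 hq'.1
  obtain ⟨p, hp, hdvd⟩ := (Nat.prime_iff.1 hqp.1).exists_mem_finset_dvd hqp.2.1
  refine ⟨p, hp, Finset.mem_filter.2 ⟨Nat.mem_primeFactors.2 ⟨hqp.1, hdvd, ?_⟩, hq'.2⟩⟩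
  exact Int.natAbs_ne_zero.2 (sub_ne_zero.2 fun h => (mem_pairs.1 hp).ne (he h))

/-- **Parasitic primes**: the primes `q > R` dividing `n ≠ 0` satisfy `∑ 1/q ≤ log n / (R log R)`
(there are at most `log n/log R` of them). [folklore] -/
theorem sum_inv_primeFactors_gt_le {n : ℕ} (hn : n ≠ 0) {R : ℝ} (hR : 1 < R) :
    ∑ q ∈ n.primeFactors.filter (fun q : ℕ => R < (q : ℝ)), (1 : ℝ) / q ≤ Real.log n / (R * Real.log R) := by
  have hlogR : 0 < Real.log R := Real.log_pos hR
  have hR0 : 0 < R := by linarith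
  set S := n.primeFactors.filter (fun q : ℕ => R < (q : ℝ)) with hS
  -- `∏_{q ∈ S} q ∣ n`
  have hdvd : ∏ q ∈ S, q ∣ n :=
    Finset.prod_primes_dvd n (fun q hq => Nat.prime_iff.1 (Nat.prime_of_mem_primeFactors (mem_filter.1 hq).1))
      (fun q hq => Nat.dvd_of_mem_primeFactors (mem_filter.1 hq).1)
  have hle : ((∏ q ∈ S, q : ℕ) : ℝ) ≤ n := by exact_mod_cast Nat.le_of_dvd (Nat.pos_of_ne_zero hn) hdvd
  have hpos : ∀ q ∈ S, (0 : ℝ) < q := fun q hq => by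
    have := (Nat.prime_of_mem_primeFactors (mem_filter.1 hq).1).pos; exact_mod_cast this
  -- `#S log R ≤ ∑ log q = log ∏ q ≤ log n`
  have hcard : (#S : ℝ) * Real.log R ≤ Real.log n := by
    calc (#S : ℝ) * Real.log R = ∑ _q ∈ S, Real.log R := by rw [sum_const, nsmul_eq_mul]
      _ ≤ ∑ q ∈ S, Real.log q := sum_le_sum fun q hq =>
          Real.log_le_log hR0 (le_of_lt (mem_filter.1 hq).2)
      _ = Real.log (∏ q ∈ S, (q : ℝ)) := (Real.log_prod (fun q hq => (hpos q hq).ne')).symm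
      _ ≤ Real.log n := by
          refine Real.log_le_log (prod_pos hpos) ?_
          have : ((∏ q ∈ S, q : ℕ) : ℝ) = ∏ q ∈ S, (q : ℝ) := by push_cast; rfl
          rw [← this]; exact hle
  calc ∑ q ∈ S, (1 : ℝ) / q ≤ ∑ _q ∈ S, 1 / R := sum_le_sum fun q hq =>
        div_le_div_of_nonneg_left zero_le_one hR0 (le_of_lt (mem_filter.1 hq).2)
    _ = #S / R := by rw [sum_const, nsmul_eq_mul, mul_one_div]
    _ ≤ (Real.log n / Real.log R) / R := by
        gcongr
        rwa [le_div_iff₀ hlogR]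
    _ = Real.log n / (R * Real.log R) := by rw [div_div, mul_comm]

/-- `exp(C ∑_{k ∈ P} Y_k) ≤ ∑_{k ∈ P} exp(#P · C · Y_k)` for a nonempty `P` (the largest term dominates).
[folklore] -/
theorem exp_mul_sum_le_sum_exp {β : Type*} {P : Finset β} (hP : P.Nonempty) (C : ℝ) (Y : β → ℝ) :
    Real.exp (C * ∑ k ∈ P, Y k) ≤ ∑ k ∈ P, Real.exp (#P * C * Y k) := by
  obtain ⟨k₀, hk₀, hmax⟩ := exists_mem_eq_sup' hP (fun k => C * Y k)
  have hle : ∀ k ∈ P, C * Y k ≤ C * Y k₀ := fun k hk => by rw [← hmax]; exact le_sup' (fun k => C * Y k) hk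
  calc Real.exp (C * ∑ k ∈ P, Y k) = Real.exp (∑ k ∈ P, C * Y k) := by rw [mul_sum]
    _ ≤ Real.exp (∑ _k ∈ P, C * Y k₀) := Real.exp_le_exp.2 (sum_le_sum hle)
    _ = Real.exp (#P * C * Y k₀) := by rw [sum_const, nsmul_eq_mul, mul_assoc]
    _ ≤ ∑ k ∈ P, Real.exp (#P * C * Y k) :=
        single_le_sum (f := fun k => Real.exp (#P * C * Y k)) (fun k _ => (Real.exp_pos _).le) hk₀

/-- `∑_{i<i'} F(i,i') = ∑_i ∑_{i'} 1_{i<i'} F(i,i')`. [folklore] -/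
theorem sum_pairs_eq_sum_ite (F : Fin m × Fin m → ℝ) :
    ∑ p ∈ pairs m, F p = ∑ i : Fin m, ∑ i' : Fin m, if i < i' then F (i, i') else 0 := by
  unfold pairs
  rw [sum_filter, ← univ_product_univ, sum_product]

/-- `#pairs ≥ 1` for `m ≥ 2`. [folklore] -/
theorem pairs_nonempty (hm : 2 ≤ m) : (pairs m).Nonempty :=
  ⟨(⟨0, by omega⟩, ⟨1, by omega⟩), mem_pairs.2 (by simp [Fin.lt_def])⟩

end ExcSum


/-! ### The shifts of the residue trick for a correlation -/

section Shifts

/-- `∏_{w < p ≤ n} p ≥ 1`. [folklore] -/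
theorem midPrimorial_pos (w n : ℕ) : 0 < midPrimorial w n := by
  unfold midPrimorial
  exact prod_pos fun p hp => (mem_filter.1 hp).2.1.pos

/-- **Good shifts**: `k_j` with `W k_j + 1 ≡ b_j (mod ∏_{w<p≤n} p)`, making the shifted
`e_j = h_j + k_j` pairwise distinct, of controlled size `0 ≤ k_j ≤ M(1 + m(2N + M + 1))`. [folklore] -/
theorem exists_good_shifts (w n N : ℕ) (b : Fin m → ℕ) (h : Fin m → ℤ) (hh : ∀ j, |h j| ≤ N) :
    ∃ k : Fin m → ℤ, (∀ j, (midPrimorial w n : ℤ) ∣ (primorial w : ℤ) * k j + 1 - b j) ∧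
      Function.Injective (fun j => h j + k j) ∧
      ∀ j, 0 ≤ k j ∧ k j ≤ (midPrimorial w n : ℤ) * (1 + m * (2 * N + midPrimorial w n + 1)) := by
  set M : ℕ := midPrimorial w n with hM
  have hM0 : 0 < M := midPrimorial_pos w n
  have hMz : (0 : ℤ) < M := by exact_mod_cast hM0
  have hM1 : (1 : ℤ) ≤ M := by exact_mod_cast hM0
  have hk0 : ∀ j, ∃ k : ℤ, (M : ℤ) ∣ (primorial w : ℤ) * k + 1 - b j := fun j => exists_shift w n (b j)
  choose k₀ hk₀ using hk0
  set D : ℤ := (M : ℤ) * (2 * N + M + 1) with hD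
  have hD0 : 0 ≤ D := by positivity
  have hDge : 2 * (N : ℤ) + M + 1 ≤ D := by
    rw [hD]; nlinarith
  have hmod : ∀ j, 0 ≤ k₀ j % M ∧ k₀ j % M < M := fun j => ⟨Int.emod_nonneg _ hMz.ne', Int.emod_lt_of_pos _ hMz⟩
  refine ⟨fun j => k₀ j % M + (j : ℕ) * D, fun j => ?_, ?_, fun j => ?_⟩
  · -- divisibility is preserved
    have e : (primorial w : ℤ) * (k₀ j % M + (j : ℕ) * D) + 1 - b j =
        ((primorial w : ℤ) * k₀ j + 1 - b j) + (M : ℤ) * ((primorial w : ℤ) * ((j : ℕ) * (2 * N + M + 1) - k₀ j / M)) := by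
      rw [Int.emod_def, hD]; ring
    rw [e]
    exact dvd_add (hk₀ j) (dvd_mul_right _ _)
  · -- injectivity
    intro j j' hjj'
    by_contra hne
    have hv : (j : ℕ) ≠ (j' : ℕ) := fun h => hne (Fin.ext h)
    simp only at hjj'
    have hb : ∀ a : Fin m, -(N : ℤ) ≤ h a ∧ h a ≤ N := fun a => abs_le.1 (hh a)
    rcases Nat.lt_or_gt_of_ne hv with hlt | hlt
    · have h1 : (1 : ℤ) ≤ ((j' : ℕ) : ℤ) - ((j : ℕ) : ℤ) := by
        have : ((j : ℕ) : ℤ) < ((j' : ℕ) : ℤ) := by exact_mod_cast hlt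
        linarith
      have h2 : 1 * D ≤ (((j' : ℕ) : ℤ) - ((j : ℕ) : ℤ)) * D := mul_le_mul_of_nonneg_right h1 hD0
      nlinarith [hb j, hb j', hmod j, hmod j', h2, hDge]
    · have h1 : (1 : ℤ) ≤ ((j : ℕ) : ℤ) - ((j' : ℕ) : ℤ) := by
        have : ((j' : ℕ) : ℤ) < ((j : ℕ) : ℤ) := by exact_mod_cast hlt
        linarith
      have h2 : 1 * D ≤ (((j : ℕ) : ℤ) - ((j' : ℕ) : ℤ)) * D := mul_le_mul_of_nonneg_right h1 hD0
      nlinarith [hb j, hb j', hmod j, hmod j', h2, hDge]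
  · -- size
    have hj : ((j : ℕ) : ℤ) ≤ m := by exact_mod_cast j.2.le
    have hj0 : (0 : ℤ) ≤ ((j : ℕ) : ℤ) := by positivity
    constructor
    · nlinarith [hmod j]
    · calc k₀ j % M + (j : ℕ) * D ≤ M + m * D := add_le_add (hmod j).2.le (mul_le_mul_of_nonneg_right hj hD0)
        _ = (M : ℤ) * (1 + m * (2 * N + M + 1)) := by rw [hD]; ring

/-- The difference `Δ = W(h_i - h_{i'}) + b_i - b_{i'}` of two distinct unwrapped shifts is non-zero
(`1 ≤ b ≤ W`). [cite: GreenTao2010, App. D (proof of Prop. 6.4)] -/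
theorem delta_ne_zero {W : ℕ} {b : Fin m → ℕ} (hb : ∀ j, 1 ≤ b j ∧ b j ≤ W) {h : Fin m → ℤ} {i i' : Fin m}
    (hne : (h i, b i) ≠ (h i', b i')) : (W : ℤ) * (h i - h i') + b i - b i' ≠ 0 := by
  intro h0
  by_cases hh : h i = h i'
  · have : (b i : ℤ) = b i' := by rw [hh, sub_self, mul_zero, zero_add, sub_eq_zero] at h0; exact h0
    exact hne (Prod.ext hh (by exact_mod_cast this))
  · have h1 : (1 : ℤ) ≤ |h i - h i'| := Int.one_le_abs (sub_ne_zero.2 hh)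
    have hbi := hb i; have hbi' := hb i'
    have h2 : |(b i : ℤ) - b i'| < W := by
      rw [abs_lt]; constructor <;> omega
    have h3 : (W : ℤ) * (h i - h i') = -(b i - b i' : ℤ) := by linarith
    have h4 : (W : ℤ) * |h i - h i'| = |(b i : ℤ) - b i'| := by
      rw [← abs_of_nonneg (by positivity : (0 : ℤ) ≤ W), ← abs_mul, h3, abs_neg]
    have h5 : (W : ℤ) ≤ (W : ℤ) * |h i - h i'| := by nlinarith
    linarith

/-- **Small exceptional primes divide `Δ`**: for the good shifts, a prime `w < q ≤ R` dividing
`e_i - e_{i'}` divides `Δ_{ii'} = W(h_i - h_{i'}) + b_i - b_{i'}` (both `W k + 1 - b` are divisible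
by `∏_{w<p≤R} p ∋ q`), so `∑_{q ≤ R} 1/q ≤ ∑_{q ∣ Δ, q > w} q^{-1/2}`. [cite: GreenTao2010, App. D (Thm. D.3)] -/
theorem sum_small_le_roughSum {w n W : ℕ} (hW : (W : ℤ) = primorial w) {b : Fin m → ℕ} {h k : Fin m → ℤ}
    (hk : ∀ j, (midPrimorial w n : ℤ) ∣ (primorial w : ℤ) * k j + 1 - b j) {i i' : Fin m}
    (hΔ : (W : ℤ) * (h i - h i') + b i - b i' ≠ 0) :
    ∑ q ∈ (roughPrimeFactors w ((h i + k i) - (h i' + k i')).natAbs).filter (fun q => q ≤ n), (1 : ℝ) / q ≤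
      ∑ p ∈ roughPrimeFactors w ((W : ℤ) * (h i - h i') + b i - b i').natAbs, (p : ℝ) ^ (-(1 / 2 : ℝ)) := by
  have hsub : (roughPrimeFactors w ((h i + k i) - (h i' + k i')).natAbs).filter (fun q => q ≤ n) ⊆
      roughPrimeFactors w ((W : ℤ) * (h i - h i') + b i - b i').natAbs := by
    intro q hq
    rw [mem_filter] at hq
    obtain ⟨hq, hqn⟩ := hq
    unfold roughPrimeFactors at hq ⊢
    rw [mem_filter] at hq ⊢
    obtain ⟨hqf, hwq⟩ := hq
    have hqp := Nat.prime_of_mem_primeFactors hqf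
    have hqdvd : (q : ℤ) ∣ (h i + k i) - (h i' + k i') := Int.dvd_natAbs.1 (Int.natCast_dvd_natCast.2 (Nat.dvd_of_mem_primeFactors hqf))
    -- `q ∣ M`
    have hqM : (q : ℤ) ∣ (midPrimorial w n : ℤ) := by
      refine Int.natCast_dvd_natCast.2 (dvd_prod_of_mem (fun p => p) (mem_filter.2 ⟨mem_range.2 (by omega), hqp, hwq⟩))
    have h1 := hqM.trans (hk i)
    have h2 := hqM.trans (hk i')
    -- `W f - Δ = (Wk_i + 1 - b_i) - (Wk_{i'} + 1 - b_{i'})`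
    have hkey : (q : ℤ) ∣ (W : ℤ) * ((h i + k i) - (h i' + k i')) - ((W : ℤ) * (h i - h i') + b i - b i') := by
      have e : (W : ℤ) * ((h i + k i) - (h i' + k i')) - ((W : ℤ) * (h i - h i') + b i - b i') =
          ((primorial w : ℤ) * k i + 1 - b i) - ((primorial w : ℤ) * k i' + 1 - b i') := by rw [hW]; ring
      rw [e]; exact dvd_sub h1 h2
    have hΔdvd : (q : ℤ) ∣ (W : ℤ) * (h i - h i') + b i - b i' := by
      have := dvd_sub (hqdvd.mul_left (W : ℤ)) hkey
      rwa [sub_sub_cancel] at this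
    refine ⟨Nat.mem_primeFactors.2 ⟨hqp, Int.natCast_dvd_natCast.1 (Int.dvd_natAbs.2 hΔdvd), Int.natAbs_ne_zero.2 hΔ⟩, hwq⟩
  calc ∑ q ∈ (roughPrimeFactors w ((h i + k i) - (h i' + k i')).natAbs).filter (fun q => q ≤ n), (1 : ℝ) / q
      ≤ ∑ q ∈ (roughPrimeFactors w ((h i + k i) - (h i' + k i')).natAbs).filter (fun q => q ≤ n), (q : ℝ) ^ (-(1 / 2 : ℝ)) := by
        refine sum_le_sum fun q hq => ?_
        have hq1 : (1 : ℝ) ≤ q := by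
          have := (Nat.prime_of_mem_primeFactors (mem_filter.1 (mem_filter.1 hq).1).1).one_lt
          exact_mod_cast this.le
        rw [one_div, ← Real.rpow_neg_one]
        exact Real.rpow_le_rpow_of_exponent_le hq1 (by norm_num)
    _ ≤ _ := sum_le_sum_of_subset_of_nonneg hsub fun q _ _ => by positivity

end Shifts


/-! ### The expectation side: from the unwrapped correlation sum to the tuple sum -/

section Expect

variable {χ : ℝ → ℝ}

/-- Sums over `[a, a + ℓ)` as sums over the one-dimensional box of the engine. [folklore] -/
theorem sum_Ico_eq_sum_box (s : Finset ℤ) (G : (Fin 1 → ℤ) → ℝ) :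
    ∑ n ∈ s, G (fun _ => n) = ∑ x ∈ Fintype.piFinset (fun _ : Fin 1 => s), G x := by
  refine Finset.sum_nbij' (fun n => fun _ => n) (fun x => x 0) (fun n hn => Fintype.mem_piFinset.2 fun _ => hn)
    (fun x hx => Fintype.mem_piFinset.1 hx 0) (fun n _ => rfl) (fun x _ => ?_) (fun n _ => rfl)
  funext i
  rw [Subsingleton.elim i 0]

/-- **The residue trick and the normalisation `Λ_{χ,R,2} = Λ_{χ,R}²/log R` on a correlation**:
`∏_j Λ_{χ,R,2}(W(n + h_j) + b_j) = (log R)^{-m} ∏_j Λ_{χ,R}(W(n + e_j) + 1)²`, `e_j = h_j + k_j`.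
[cite: GreenTao2010, App. D (proof of Prop. 6.4)] -/
theorem corr_prod_eq (χ : ℝ → ℝ) {R : ℝ} (hR : Real.log R ≠ 0) {w : ℕ} {b : Fin m → ℕ}
    (hb : ∀ j, Nat.Coprime (b j) (primorial w)) {k : Fin m → ℤ}
    (hk : ∀ j, (midPrimorial w ⌊R⌋₊ : ℤ) ∣ (primorial w : ℤ) * k j + 1 - b j) (h : Fin m → ℤ) (n : ℤ) :
    ∏ j, truncDivisorSum χ R 2 ((primorial w : ℤ) * (n + h j) + b j) =
      (Real.log R)⁻¹ ^ m * ∏ j, smoothDivisorSum χ R (primorial w * (∑ i : Fin 1, corrL m j i * (fun _ : Fin 1 => n) i + (h j + k j)) + 1) ^ 2 := by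
  rw [show (Real.log R)⁻¹ ^ m = ∏ _j : Fin m, (Real.log R)⁻¹ by simp, ← prod_mul_distrib]
  refine prod_congr rfl fun j _ => ?_
  rw [truncDivisorSum_shift χ R 2 (hb j) (hk j), truncDivisorSum_two_eq χ hR]
  congr 3
  simp only [corrL, Fin.sum_univ_one, one_mul]
  ring

/-- **The correlation sum over a long interval is controlled by the tuple sum**: for `|χ| ≤ 1`,
`R > 1` and `ℓ ≥ R^{2m}`,
`∑_{n ∈ [a, a+ℓ)} ∏_j Λ_{χ,R}(W(n + e_j) + 1)² ≤ ℓ (log R)^{2m} (‖trueSum‖ + R^{4m}/ℓ)`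
(the tree's `CFZ.exists_expect_eq` in one variable). [cite: ConlonFoxZhao2014, Section 9, equations (28)–(29)] -/
theorem corr_interval_sum_le (hχ1 : ∀ x, |χ x| ≤ 1) {R : ℝ} (hR : 1 < R) (w : ℕ) (e : Fin m → ℤ) (a : ℤ)
    {ℓ : ℕ} (hℓ : R ^ (2 * m) ≤ ℓ) :
    ∑ n ∈ Ico a (a + ℓ), ∏ j, smoothDivisorSum χ R (primorial w * (∑ i : Fin 1, corrL m j i * (fun _ : Fin 1 => n) i + e j) + 1) ^ 2 ≤
      ℓ * Real.log R ^ (2 * m) * (‖trueSumC χ R (primorial w) (corrL m) e‖ + R ^ (4 * m) / ℓ) := by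
  have hR0 : 0 < R := by linarith
  have hℓ0 : (0 : ℝ) < ℓ := lt_of_lt_of_le (by positivity) hℓ
  set G : (Fin 1 → ℤ) → ℝ := fun x => ∏ j, smoothDivisorSum χ R (primorial w * (∑ i : Fin 1, corrL m j i * x i + e j) + 1) ^ 2
    with hG
  have hsum : ∑ n ∈ Ico a (a + ℓ), G (fun _ => n) = ∑ x ∈ Fintype.piFinset (fun _ : Fin 1 => Ico a (a + ℓ)), G x :=
    sum_Ico_eq_sum_box _ G
  have hcard : (#(Fintype.piFinset (fun _ : Fin 1 => Ico a (a + (ℓ : ℤ)))) : ℝ) = ℓ := by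
    rw [Fintype.card_piFinset, prod_const, card_univ, Fintype.card_fin, pow_one, Int.card_Ico]
    simp
  obtain ⟨E₃, hE₃, hexp⟩ := exists_expect_eq hχ1 hR.le (primorial w) (corrL m) e (fun _ : Fin 1 => a) (fun _ => ℓ)
    (fun _ => hℓ)
  have hexp' : ∑ x ∈ Fintype.piFinset (fun _ : Fin 1 => Ico a (a + (ℓ : ℤ))), G x =
      ℓ * (Real.log R ^ (2 * m) * (trueSumR χ R (primorial w) (corrL m) e + E₃)) := by
    have h := hexp
    rw [Finset.expect_eq_sum_div_card, hcard, div_eq_iff hℓ0.ne'] at h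
    simp only [hG]
    rw [h]
    ring
  have hE₃' : |E₃| ≤ R ^ (4 * m) / ℓ := by
    refine hE₃.trans (le_of_eq ?_)
    rw [Fin.sum_univ_one, show (4 : ℕ) * m = 2 * m + 2 * m by ring, pow_add]
    ring
  have htrue : |trueSumR χ R (primorial w) (corrL m) e| = ‖trueSumC χ R (primorial w) (corrL m) e‖ := by
    rw [← trueSumR_cast, Complex.norm_real, Real.norm_eq_abs]
  show ∑ n ∈ Ico a (a + ℓ), G (fun _ => n) ≤ _
  rw [hsum, hexp']
  have hK : 0 ≤ Real.log R ^ (2 * m) := pow_nonneg (Real.log_nonneg hR.le) _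
  calc (ℓ : ℝ) * (Real.log R ^ (2 * m) * (trueSumR χ R (primorial w) (corrL m) e + E₃))
      ≤ ℓ * (Real.log R ^ (2 * m) * (|trueSumR χ R (primorial w) (corrL m) e| + |E₃|)) := by
        gcongr
        · exact le_abs_self _
        · exact le_abs_self _
    _ ≤ ℓ * (Real.log R ^ (2 * m) * (‖trueSumC χ R (primorial w) (corrL m) e‖ + R ^ (4 * m) / ℓ)) := by
        rw [htrue]; gcongr
    _ = _ := by ring

end Expect

/-! ### Smallness of the box parameters, uniformly in the cutoff -/

section Smallness

/-- For `K = log R ≥ K₁(m, δ₀, K₀)` and `1 ≤ w ≤ K^{1/8}`, with `T = K^{1/2}`: `δ ≤ δ₀`,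
`2δ log w ≤ 1/8`, `β ≤ 1/2` and `α ≤ 1` (the smallness conditions of the pointwise main-term
comparison), uniformly in `w`. [cite: ConlonFoxZhao2014, Section 9] -/
theorem corr_smallness (m : ℕ) {δ₀ : ℝ} (hδ₀ : 0 < δ₀) {K₀ : ℝ} (hK₀ : 0 ≤ K₀) :
    ∃ K₁ : ℝ, 1 ≤ K₁ ∧ ∀ R : ℝ, K₁ ≤ Real.log R → ∀ w : ℕ, 1 ≤ w → (w : ℝ) ≤ Real.log R ^ (1 / 8 : ℝ) →
      deltaOf R (Real.sqrt (Real.log R)) ≤ δ₀ ∧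
      2 * deltaOf R (Real.sqrt (Real.log R)) * Real.log w ≤ 1 / 8 ∧
      betaErr (deltaOf R (Real.sqrt (Real.log R))) m w ≤ 1 / 2 ∧
      alphaErr K₀ (deltaOf R (Real.sqrt (Real.log R))) m ≤ 1 := by
  have hYev : ∀ᶠ K in atTop, betaBar m (sOf K) ≤ 1 / 2 :=
    ((tendsto_betaBar m).comp tendsto_sOf).eventually_le_const (by norm_num)
  have hsev : ∀ᶠ K in atTop, sOf K ≤ min δ₀ (1 / 16) := tendsto_sOf.eventually_le_const (lt_min hδ₀ (by norm_num))
  have hαc : Continuous fun s : ℝ => (1 + K₀ * s) ^ m - 1 := by fun_prop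
  have hαev : ∀ᶠ K in atTop, (1 + K₀ * sOf K) ^ m - 1 ≤ 1 := by
    have h := (hαc.tendsto 0).comp tendsto_sOf
    simp only [mul_zero, add_zero, one_pow, sub_self] at h
    exact h.eventually_le_const (by norm_num)
  obtain ⟨K₁', hK₁'⟩ := Filter.eventually_atTop.1 ((hYev.and hsev).and hαev)
  refine ⟨max K₁' 1, le_max_right _ _, fun R hKR w hw1 hwK => ?_⟩
  obtain ⟨⟨hY, hsm⟩, hα⟩ := hK₁' (Real.log R) ((le_max_left _ _).trans hKR)
  set K := Real.log R with hK_def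
  have hK1 : 1 ≤ K := (le_max_right _ _).trans hKR
  have hK0 : 0 < K := by linarith
  set δ := deltaOf R (Real.sqrt K) with hδ_def
  have hδ : 0 ≤ δ := deltaOf_nonneg (Real.sqrt_nonneg _) hK0
  obtain ⟨h1, h2, h3, h4⟩ := smallness_bounds hK1 hδ hw1 hwK
  have hs_def : δ * K ^ (1 / 4 : ℝ) = sOf K := rfl
  set s := sOf K with hs
  have hδs : δ ≤ s := by rw [← hs_def]; exact h1
  refine ⟨hδs.trans (hsm.trans (min_le_left _ _)), ?_, ?_, ?_⟩
  · have := hsm.trans (min_le_right _ _)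
    rw [← hs_def] at this
    linarith
  · refine le_trans ?_ hY
    refine (betaErr_le hδ m w).trans ?_
    unfold betaBar
    have e2 : Real.exp (m * (144 * δ * w)) = Real.exp (144 * m * (δ * w)) := by congr 1; ring
    rw [e2]
    gcongr Real.exp ?_ - 1
    calc (w + 1 : ℝ) * (m * (144 * δ * w) * Real.exp (144 * m * (δ * w)))
        = 144 * m * ((w + 1) * w * δ) * Real.exp (144 * m * (δ * w)) := by ring
      _ ≤ 144 * m * (2 * s) * Real.exp (144 * m * s) := by rw [← hs_def] at *; gcongr
      _ = 2 * s * (144 * m) * Real.exp (144 * m * s) := by ring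
  · refine le_trans ?_ hα
    unfold alphaErr
    gcongr

end Smallness


/-! ### The bound at fixed data -/

section Fixed

variable {χ : ℝ → ℝ}

/-- `(φ(W)/W)^m ≤ 1`. [folklore] -/
theorem totient_ratio_pow_le_one (W m : ℕ) (hW : 0 < W) : ((Nat.totient W : ℝ) / W) ^ m ≤ 1 := by
  refine pow_le_one₀ (by positivity) ?_
  rw [div_le_one (by exact_mod_cast hW)]
  exact_mod_cast Nat.totient_le W

/-- **The bookkeeping inequality of the correlation estimate**, pure algebra: from
`S ≤ K^{-m} ℓ K^{2m}(Tr + Rt/ℓ)`, `Tr ≤ Err₁ c κ M + B t`, `φ c = 1`, `K^m κ ≤ 1`, `φ ≤ 1`,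
`Err₁ ≤ 4 X₁`, `K^m B t ≤ D X₁`, `K^m Rt ≤ ℓ`, `1 ≤ X₁`, `ℓ ≤ 3N` one gets
`φ S ≤ 3 (4M + D + 1) X₁ N`. [folklore] -/
theorem corr_algebra {S K ℓ Tr Rt Err₁ c κ M B t φ X₁ D N : ℝ} {m : ℕ} (hK : 0 < K) (hℓ : 0 < ℓ)
    (hφ0 : 0 ≤ φ) (hφ1 : φ ≤ 1) (hM : 0 ≤ M) (hB : 0 ≤ B) (ht : 0 ≤ t) (hErr0 : 0 ≤ Err₁) (hRt : 0 ≤ Rt) (hD : 0 ≤ D)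
    (h1 : S ≤ K⁻¹ ^ m * (ℓ * K ^ (2 * m) * (Tr + Rt / ℓ))) (h2 : Tr ≤ Err₁ * c * κ * M + B * t)
    (hφc : φ * c = 1) (hKκ : K ^ m * κ ≤ 1) (hErr : Err₁ ≤ 4 * X₁) (hBt : K ^ m * B * t ≤ D * X₁)
    (hKE : K ^ m * Rt ≤ ℓ) (hX₁ : 1 ≤ X₁) (hℓN : ℓ ≤ 3 * N) :
    φ * S ≤ 3 * (4 * M + D + 1) * X₁ * N := by
  have hKm : 0 < K ^ m := pow_pos hK m
  have hid : K⁻¹ ^ m * (ℓ * K ^ (2 * m) * (Tr + Rt / ℓ)) = ℓ * K ^ m * Tr + K ^ m * Rt := by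
    rw [inv_pow, pow_mul, sq]
    field_simp
    ring
  rw [hid] at h1
  -- the tuple-sum term
  have hA : φ * (ℓ * K ^ m * Tr) ≤ ℓ * (4 * X₁) * M + ℓ * (D * X₁) := by
    calc φ * (ℓ * K ^ m * Tr) ≤ φ * (ℓ * K ^ m * (Err₁ * c * κ * M + B * t)) := by gcongr
      _ = ℓ * (φ * c) * (K ^ m * κ) * Err₁ * M + φ * (ℓ * (K ^ m * B * t)) := by ring
      _ ≤ ℓ * 1 * 1 * (4 * X₁) * M + 1 * (ℓ * (D * X₁)) := by
          rw [hφc]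
          gcongr
      _ = ℓ * (4 * X₁) * M + ℓ * (D * X₁) := by ring
  -- the box-error term
  have hC : φ * (K ^ m * Rt) ≤ ℓ * X₁ := by
    calc φ * (K ^ m * Rt) ≤ 1 * ℓ := mul_le_mul hφ1 hKE (by positivity) zero_le_one
      _ = ℓ * 1 := by ring
      _ ≤ ℓ * X₁ := mul_le_mul_of_nonneg_left hX₁ hℓ.le
  have hX0 : 0 ≤ X₁ := zero_le_one.trans hX₁
  calc φ * S ≤ φ * (ℓ * K ^ m * Tr + K ^ m * Rt) := mul_le_mul_of_nonneg_left h1 hφ0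
    _ = φ * (ℓ * K ^ m * Tr) + φ * (K ^ m * Rt) := by ring
    _ ≤ (ℓ * (4 * X₁) * M + ℓ * (D * X₁)) + ℓ * X₁ := add_le_add hA hC
    _ = ℓ * ((4 * M + D + 1) * X₁) := by ring
    _ ≤ (3 * N) * ((4 * M + D + 1) * X₁) := mul_le_mul_of_nonneg_right hℓN (by positivity)
    _ = 3 * (4 * M + D + 1) * X₁ * N := by ring

/-- **The correlation estimate at fixed data.** With `R` the level (`log R ≥ 1`, `R^{5m} ≤ N`),
`w ≥ 21m+2`, good shifts `k` (`W k_j + 1 ≡ b_j`, `e_j = h_j + k_j` pairwise distinct) and the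
smallness conditions of the box analysis (`T = (log R)^{1/2}`):
`(φ(W)/W)^m ∑_{-N ≤ n ≤ N} ∏_j Λ_{χ,R,2}(W(n+h_j) + b_j) ≤ 3 C₁ e^{deltaConst} e^{deltaConst · X} · N`,
`X` the exceptional sum of `e`, `C₁ = 4 M₂^{2m} + (1+C_D)^{3m} 2m M_A M₂^{2m-1} + 1`.
[cite: GreenTao2010, App. D (proof of Prop. 6.4, the correlation estimate, and Thm. D.3)]
[cite: ConlonFoxZhao2014, Section 9] -/
theorem corr_fixed_bound (hs : ContDiff ℝ (⊤ : ℕ∞) χ) (hsupp : ∀ x, 1 ≤ |x| → χ x = 0) (hχ1 : ∀ x, |χ x| ≤ 1)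
    {R : ℝ} (hR0 : 0 < R) (hK1 : 1 ≤ Real.log R) {N : ℕ} (hN : 1 ≤ N) (hR5 : R ^ (5 * m) ≤ N)
    {w : ℕ} (hw : 21 * m + 2 ≤ w) {b : Fin m → ℕ} (hb : ∀ j, Nat.Coprime (b j) (primorial w)) {h k : Fin m → ℤ}
    (hk : ∀ j, (midPrimorial w ⌊R⌋₊ : ℤ) ∣ (primorial w : ℤ) * k j + 1 - b j)
    (he : Function.Injective (fun j => h j + k j)) {δ₀ K₀ : ℝ} (hK₀ : 0 ≤ K₀)
    (hζ : ∀ z z' : ℂ, z ≠ 0 → z' ≠ 0 → z + z' ≠ 0 → ∀ δ : ℝ, δ ≤ δ₀ → ‖z‖ ≤ δ → ‖z'‖ ≤ δ →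
      ‖riemannZeta (1 + z + z') / (riemannZeta (1 + z) * riemannZeta (1 + z')) - z * z' / (z + z')‖ ≤
        K₀ * δ * ‖z * z' / (z + z')‖)
    (hδ₀ : deltaOf R (Real.sqrt (Real.log R)) ≤ δ₀)
    (hδw : 2 * deltaOf R (Real.sqrt (Real.log R)) * Real.log w ≤ 1 / 8)
    (hβ : betaErr (deltaOf R (Real.sqrt (Real.log R))) m w ≤ 1 / 2)
    (hα : alphaErr K₀ (deltaOf R (Real.sqrt (Real.log R))) m ≤ 1)
    {CD : ℝ} (hCD : 0 ≤ CD)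
    (hDom : ∀ (Q : ℕ) (η : Fin m ⊕ Fin m → ℝ),
      ‖∏ p ∈ Q.primesBelow, eulerFactor p (primorial w) (corrL m) (fun j => h j + k j) (zL R η) (zR R η)‖ ≤
        (Real.log R + CD) ^ (3 * m) * Real.exp (deltaConst m * (1 / (w : ℝ) + excSum w (fun j => h j + k j)))) :
    ((Nat.totient (primorial w) : ℝ) / primorial w) ^ m *
        ∑ n ∈ Ico (-(N : ℤ)) (-(N : ℤ) + ((2 * N + 1 : ℕ) : ℤ)),
          ∏ j, truncDivisorSum χ R 2 ((primorial w : ℤ) * (n + h j) + b j) ≤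
      3 * (4 * (∫ x, phiWeight χ x) ^ (2 * m) +
            (1 + CD) ^ (3 * m) * ((2 * m : ℕ) * weightMoment χ (14 * m + 2) * (∫ x, phiWeight χ x) ^ (2 * m - 1)) + 1) *
        (Real.exp (deltaConst m) * Real.exp (deltaConst m * excSum w (fun j => h j + k j))) * N := by
  have hlogR : 0 < Real.log R := by linarith
  have hR1 : 1 < R := by
    by_contra hc
    have := Real.log_nonpos hR0.le (not_lt.1 hc); linarith
  have hX0 : 0 ≤ excSum w (fun j => h j + k j) := excSum_nonneg w _
  have hdC0 : 0 ≤ deltaConst m := deltaConst_nonneg m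
  have hM₂0 : 0 ≤ ∫ x, phiWeight χ x := integral_nonneg (phiWeight_nonneg χ)
  have hMA0 : 0 ≤ weightMoment χ (14 * m + 2) := weightMoment_nonneg χ _
  have hW0 : 0 < primorial w := primorial_pos w
  have hφW0 : 0 < ((Nat.totient (primorial w) : ℝ) / primorial w) ^ m := by
    have : (0 : ℝ) < Nat.totient (primorial w) := by exact_mod_cast Nat.totient_pos.2 hW0
    positivity
  have hφW1 := totient_ratio_pow_le_one (primorial w) m hW0
  have hT1 : 1 ≤ Real.sqrt (Real.log R) := by
    rw [show (1 : ℝ) = Real.sqrt 1 by simp]; exact Real.sqrt_le_sqrt hK1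
  have hN1 : (1 : ℝ) ≤ N := by exact_mod_cast hN
  have hℓ0 : (0 : ℝ) < ((2 * N + 1 : ℕ) : ℝ) := by positivity
  have hℓ3 : (((2 * N + 1 : ℕ) : ℝ)) ≤ 3 * N := by push_cast; linarith
  have hR2 : R ^ (2 * m) ≤ ((2 * N + 1 : ℕ) : ℝ) := by
    calc R ^ (2 * m) ≤ R ^ (5 * m) := pow_le_pow_right₀ hR1.le (by omega)
      _ ≤ N := hR5
      _ ≤ ((2 * N + 1 : ℕ) : ℝ) := by push_cast; linarith
  have hw1 : (1 : ℝ) ≤ w := by exact_mod_cast (show 1 ≤ w by omega)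
  -- Step 1: residue trick and the expectation side
  have hstep1 : ∑ n ∈ Ico (-(N : ℤ)) (-(N : ℤ) + ((2 * N + 1 : ℕ) : ℤ)),
      ∏ j, truncDivisorSum χ R 2 ((primorial w : ℤ) * (n + h j) + b j) ≤
      (Real.log R)⁻¹ ^ m * (((2 * N + 1 : ℕ) : ℝ) * Real.log R ^ (2 * m) *
        (‖trueSumC χ R (primorial w) (corrL m) (fun j => h j + k j)‖ + R ^ (4 * m) / ((2 * N + 1 : ℕ) : ℝ))) := by
    rw [sum_congr rfl fun n _ => corr_prod_eq χ hlogR.ne' hb hk h n, ← mul_sum]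
    refine mul_le_mul_of_nonneg_left ?_ (by positivity)
    exact corr_interval_sum_le hχ1 hR1 w (fun j => h j + k j) _ hR2
  -- Step 2: the tuple sum and the tail
  have htrue := norm_corr_trueSumC_le hs hsupp hR0 hK1 hw he (Real.sqrt_nonneg _) hK₀ hζ hδ₀ hδw hβ hDom
  have htail : tailBox χ m (Real.sqrt (Real.log R)) ≤ (2 * m : ℕ) * (((Real.sqrt (Real.log R)) ^ (14 * m + 2))⁻¹ *
      weightMoment χ (14 * m + 2)) * (∫ x, phiWeight χ x) ^ (2 * m - 1) := tailBox_le hs hsupp _ hT1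
  -- Step 3: the constants
  have hexpw : Real.exp (deltaConst m * (1 / (w : ℝ) + excSum w (fun j => h j + k j))) ≤
      Real.exp (deltaConst m) * Real.exp (deltaConst m * excSum w (fun j => h j + k j)) := by
    rw [← Real.exp_add]
    refine Real.exp_le_exp.2 ?_
    have : deltaConst m * (1 / (w : ℝ)) ≤ deltaConst m := by rw [mul_one_div]; exact div_le_self hdC0 hw1
    nlinarith
  have hErr : 1 + corrErr K₀ (deltaOf R (Real.sqrt (Real.log R))) m w (excSum w (fun j => h j + k j)) ≤
      4 * (Real.exp (deltaConst m) * Real.exp (deltaConst m * excSum w (fun j => h j + k j))) := by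
    unfold corrErr
    have ha0 := alphaErr_nonneg hK₀ (deltaOf_nonneg (Real.sqrt_nonneg (Real.log R)) hlogR) m
    have hb0 := betaErr_nonneg (deltaOf_nonneg (Real.sqrt_nonneg (Real.log R)) hlogR) m w
    rw [add_sub_cancel]
    calc (1 + alphaErr K₀ (deltaOf R (Real.sqrt (Real.log R))) m) * (1 + 2 * betaErr (deltaOf R (Real.sqrt (Real.log R))) m w) *
          Real.exp (deltaConst m * (1 / (w : ℝ) + excSum w (fun j => h j + k j)))
        ≤ 2 * 2 * (Real.exp (deltaConst m) * Real.exp (deltaConst m * excSum w (fun j => h j + k j))) :=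
          mul_le_mul (mul_le_mul (by linarith) (by linarith) (by positivity) (by norm_num)) hexpw (by positivity) (by norm_num)
      _ = _ := by ring
  have hKκ : Real.log R ^ m * ((2 * Real.log R) ^ m)⁻¹ ≤ 1 := by
    rw [mul_pow, mul_inv, ← mul_assoc, mul_comm (Real.log R ^ m), mul_assoc, mul_inv_cancel₀ (pow_ne_zero _ hlogR.ne'), mul_one]
    exact inv_le_one_of_one_le₀ (one_le_pow₀ (by norm_num))
  have hKB : Real.log R ^ m * (Real.log R + CD) ^ (3 * m) * ((Real.sqrt (Real.log R)) ^ (14 * m + 2))⁻¹ ≤ (1 + CD) ^ (3 * m) := by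
    set K := Real.log R with hK_def
    have hT : Real.sqrt K ^ (14 * m + 2) = K ^ (7 * m + 1) := by
      rw [show 14 * m + 2 = 2 * (7 * m + 1) by ring, pow_mul, Real.sq_sqrt hlogR.le]
    rw [hT]
    have h1 : (K + CD) ^ (3 * m) ≤ ((1 + CD) * K) ^ (3 * m) := pow_le_pow_left₀ (by positivity) (by nlinarith) _
    calc K ^ m * (K + CD) ^ (3 * m) * (K ^ (7 * m + 1))⁻¹ ≤ K ^ m * ((1 + CD) * K) ^ (3 * m) * (K ^ (7 * m + 1))⁻¹ := by
          gcongr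
      _ = (1 + CD) ^ (3 * m) * (K ^ (4 * m) * (K ^ (7 * m + 1))⁻¹) := by rw [mul_pow]; ring
      _ ≤ (1 + CD) ^ (3 * m) * 1 := by
          refine mul_le_mul_of_nonneg_left ?_ (by positivity)
          rw [mul_inv_le_iff₀ (by positivity), one_mul]
          exact pow_le_pow_right₀ hK1 (by omega)
      _ = (1 + CD) ^ (3 * m) := mul_one _
  have hBt : Real.log R ^ m * ((Real.log R + CD) ^ (3 * m) * Real.exp (deltaConst m * (1 / (w : ℝ) + excSum w (fun j => h j + k j)))) *
      tailBox χ m (Real.sqrt (Real.log R)) ≤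
      ((1 + CD) ^ (3 * m) * ((2 * m : ℕ) * weightMoment χ (14 * m + 2) * (∫ x, phiWeight χ x) ^ (2 * m - 1))) *
        (Real.exp (deltaConst m) * Real.exp (deltaConst m * excSum w (fun j => h j + k j))) := by
    have htail0 : 0 ≤ tailBox χ m (Real.sqrt (Real.log R)) := tailBox_nonneg χ m _
    calc Real.log R ^ m * ((Real.log R + CD) ^ (3 * m) * Real.exp (deltaConst m * (1 / (w : ℝ) + excSum w (fun j => h j + k j)))) *
          tailBox χ m (Real.sqrt (Real.log R))
        ≤ Real.log R ^ m * ((Real.log R + CD) ^ (3 * m) * (Real.exp (deltaConst m) * Real.exp (deltaConst m * excSum w (fun j => h j + k j)))) *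
          ((2 * m : ℕ) * (((Real.sqrt (Real.log R)) ^ (14 * m + 2))⁻¹ * weightMoment χ (14 * m + 2)) * (∫ x, phiWeight χ x) ^ (2 * m - 1)) := by
          gcongr
      _ = (Real.log R ^ m * (Real.log R + CD) ^ (3 * m) * ((Real.sqrt (Real.log R)) ^ (14 * m + 2))⁻¹) *
          ((2 * m : ℕ) * weightMoment χ (14 * m + 2) * (∫ x, phiWeight χ x) ^ (2 * m - 1)) *
          (Real.exp (deltaConst m) * Real.exp (deltaConst m * excSum w (fun j => h j + k j))) := by ring
      _ ≤ (1 + CD) ^ (3 * m) * ((2 * m : ℕ) * weightMoment χ (14 * m + 2) * (∫ x, phiWeight χ x) ^ (2 * m - 1)) *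
          (Real.exp (deltaConst m) * Real.exp (deltaConst m * excSum w (fun j => h j + k j))) := by
          gcongr
  have hKE : Real.log R ^ m * R ^ (4 * m) ≤ ((2 * N + 1 : ℕ) : ℝ) := by
    have hKR : Real.log R ≤ R := (Real.log_le_sub_one_of_pos hR0).trans (by linarith)
    calc Real.log R ^ m * R ^ (4 * m) ≤ R ^ m * R ^ (4 * m) := by gcongr
      _ = R ^ (5 * m) := by rw [← pow_add]; ring_nf
      _ ≤ N := hR5
      _ ≤ ((2 * N + 1 : ℕ) : ℝ) := by push_cast; linarith
  have hE1 : 1 ≤ Real.exp (deltaConst m) * Real.exp (deltaConst m * excSum w (fun j => h j + k j)) :=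
    one_le_mul_of_one_le_of_one_le (Real.one_le_exp hdC0) (Real.one_le_exp (by positivity))
  have hφcW : ((Nat.totient (primorial w) : ℝ) / primorial w) ^ m * cW w m = 1 := by
    unfold cW; exact mul_inv_cancel₀ hφW0.ne'
  have hErr0 : 0 ≤ 1 + corrErr K₀ (deltaOf R (Real.sqrt (Real.log R))) m w (excSum w (fun j => h j + k j)) := by
    have := corrErr_nonneg hK₀ (deltaOf_nonneg (Real.sqrt_nonneg (Real.log R)) hlogR) m w hX0; linarith
  exact corr_algebra hlogR hℓ0 hφW0.le hφW1 (by positivity) (by positivity) (tailBox_nonneg χ m _) hErr0 (by positivity)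
    (by positivity) hstep1 htrue hφcW hKκ hErr hBt hKE hE1 hℓ3

end Fixed


/-! ### The size of the shifted differences and the parasitic primes -/

section Parasitic

/-- `∏_{w < p ≤ n} p ≤ 4^n`. [folklore] -/
theorem midPrimorial_le_four_pow (w n : ℕ) : midPrimorial w n ≤ 4 ^ n := by
  refine le_trans ?_ (primorial_le_four_pow n)
  unfold midPrimorial primorial
  refine Finset.prod_le_prod_of_subset_of_one_le' (fun p hp => ?_) (fun p hp _ => (mem_filter.1 hp).2.one_lt.le)
  rw [mem_filter] at hp ⊢
  exact ⟨hp.1, hp.2.1⟩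

/-- **The parasitic primes of one pair contribute `O(1)`**: for the good shifts
(`0 ≤ k_j ≤ M(1 + m(2N+M+1))`, `M = ∏_{w<p≤R} p ≤ 4^R`), `|e_i - e_{i'}| ≤ 6 m N M²`, so the primes
`q > R` dividing it give `∑ 1/q ≤ (log(6m) + log N + 2R log 4)/(R log R) ≤ log(6m) + 4` once
`log N ≤ R log R` and `log R ≥ 1`. [folklore] -/
theorem parasitic_le (hm : 2 ≤ m) {R : ℝ} (hR1 : 1 ≤ Real.log R) (hR0 : 0 < R) {N w : ℕ} (hN : 1 ≤ N)
    (hNR : Real.log N ≤ R * Real.log R) {h k : Fin m → ℤ} (hh : ∀ j, |h j| ≤ N)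
    (hkb : ∀ j, 0 ≤ k j ∧ k j ≤ (midPrimorial w ⌊R⌋₊ : ℤ) * (1 + m * (2 * N + midPrimorial w ⌊R⌋₊ + 1)))
    {i i' : Fin m} (hf : (h i + k i) - (h i' + k i') ≠ 0) :
    ∑ q ∈ ((h i + k i) - (h i' + k i')).natAbs.primeFactors.filter (fun q : ℕ => R < (q : ℝ)), (1 : ℝ) / q ≤
      Real.log (6 * m) + 4 := by
  have hlogR : 0 < Real.log R := by linarith
  have hRe : 1 < R := by
    by_contra hc; have := Real.log_nonpos hR0.le (not_lt.1 hc); linarith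
  have hRlogR : 1 ≤ R * Real.log R := one_le_mul_of_one_le_of_one_le hRe.le hR1
  set M : ℕ := midPrimorial w ⌊R⌋₊ with hM_def
  have hM1 : (1 : ℝ) ≤ M := by exact_mod_cast midPrimorial_pos w ⌊R⌋₊
  have hM1z : (1 : ℤ) ≤ M := by exact_mod_cast midPrimorial_pos w ⌊R⌋₊
  have hN1 : (1 : ℝ) ≤ N := by exact_mod_cast hN
  have hN1z : (1 : ℤ) ≤ N := by exact_mod_cast hN
  have hm2 : (2 : ℝ) ≤ m := by exact_mod_cast hm
  have hm2z : (2 : ℤ) ≤ m := by exact_mod_cast hm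
  -- the size of `f`
  set f : ℤ := (h i + k i) - (h i' + k i') with hf_def
  have hfz : |f| ≤ 6 * m * N * (M : ℤ) ^ 2 := by
    have hb : ∀ a : Fin m, -(N : ℤ) ≤ h a ∧ h a ≤ N := fun a => abs_le.1 (hh a)
    have h1 : |f| ≤ 2 * N + (M : ℤ) * (1 + m * (2 * N + M + 1)) := by
      rw [abs_le]; constructor <;> nlinarith [hb i, hb i', hkb i, hkb i']
    have h2 : 2 * (N : ℤ) + M + 1 ≤ 4 * N * M := by nlinarith
    have h3 : (M : ℤ) * (1 + m * (2 * N + M + 1)) ≤ M + 4 * m * N * (M : ℤ) ^ 2 := by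
      have h3' := mul_le_mul_of_nonneg_left h2 (by positivity : (0 : ℤ) ≤ M * m)
      linarith [h3']
    have h4 : 2 * (N : ℤ) ≤ 2 * N * (M : ℤ) ^ 2 := by nlinarith
    have h5 : (M : ℤ) ≤ N * (M : ℤ) ^ 2 := by nlinarith
    have h6 : (3 : ℤ) * (N * (M : ℤ) ^ 2) ≤ 2 * m * (N * (M : ℤ) ^ 2) := by nlinarith
    nlinarith
  have hfabs : ((f.natAbs : ℕ) : ℝ) ≤ 6 * m * N * (M : ℝ) ^ 2 := by
    rw [Nat.cast_natAbs, Int.cast_abs]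
    exact_mod_cast hfz
  have hf0 : f.natAbs ≠ 0 := Int.natAbs_ne_zero.2 hf
  have hfpos : (0 : ℝ) < (f.natAbs : ℕ) := by exact_mod_cast Nat.pos_of_ne_zero hf0
  -- `M ≤ 4^R`
  have hM4 : (M : ℝ) ≤ (4 : ℝ) ^ R := by
    calc (M : ℝ) ≤ ((4 ^ ⌊R⌋₊ : ℕ) : ℝ) := by exact_mod_cast midPrimorial_le_four_pow w ⌊R⌋₊
      _ = (4 : ℝ) ^ ((⌊R⌋₊ : ℕ) : ℝ) := by push_cast; exact (Real.rpow_natCast _ _).symm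
      _ ≤ (4 : ℝ) ^ R := Real.rpow_le_rpow_of_exponent_le (by norm_num) (Nat.floor_le hR0.le)
  have hlogM : Real.log M ≤ R * Real.log 4 := by
    calc Real.log M ≤ Real.log ((4 : ℝ) ^ R) := Real.log_le_log (by linarith) hM4
      _ = R * Real.log 4 := Real.log_rpow (by norm_num) R
  -- `log |f| ≤ log(6m) + log N + 2R log 4`
  have hlogf : Real.log (f.natAbs : ℕ) ≤ Real.log (6 * m) + Real.log N + 2 * (R * Real.log 4) := by
    calc Real.log (f.natAbs : ℕ) ≤ Real.log (6 * m * N * (M : ℝ) ^ 2) := Real.log_le_log hfpos hfabs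
      _ = Real.log (6 * m) + Real.log N + 2 * Real.log M := by
          rw [Real.log_mul (by positivity) (by positivity), Real.log_mul (by positivity) (by positivity), Real.log_pow]
          push_cast; ring
      _ ≤ _ := by linarith
  have hlog4 : Real.log 4 ≤ 3 / 2 := by
    have h := Real.log_two_lt_d9
    rw [show (4 : ℝ) = 2 ^ 2 by norm_num, Real.log_pow]; push_cast; linarith
  have hlog6m : 0 ≤ Real.log (6 * m) := Real.log_nonneg (by linarith)
  refine (sum_inv_primeFactors_gt_le hf0 hRe).trans ?_
  rw [div_le_iff₀ (by positivity)]
  have hlogN : 0 ≤ Real.log N := Real.log_nonneg hN1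
  calc Real.log (f.natAbs : ℕ) ≤ Real.log (6 * m) + Real.log N + 2 * (R * Real.log 4) := hlogf
    _ ≤ Real.log (6 * m) * (R * Real.log R) + R * Real.log R + 3 * (R * Real.log R) := by
        have h1 : Real.log (6 * m) ≤ Real.log (6 * m) * (R * Real.log R) := le_mul_of_one_le_right hlog6m hRlogR
        have h2 : 2 * (R * Real.log 4) ≤ 3 * (R * Real.log R) := by nlinarith
        linarith
    _ = (Real.log (6 * m) + 4) * (R * Real.log R) := by ring

end Parasitic


section XBound

/-- **The exceptional sum against the right-hand side of the correlation display**: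
`X ≤ ∑_{i<i'} ∑_{p > w, p ∣ Δ_{ii'}} p^{-1/2} + #pairs · (log(6m) + 4)` for the good shifts
(small exceptional primes divide `Δ`, parasitic ones are `O(1)` per pair).
[cite: GreenTao2010, App. D (proof of Prop. 6.4 and Thm. D.3)] -/
theorem excSum_le_pairs_roughSum (hm : 2 ≤ m) {R : ℝ} (hR1 : 1 ≤ Real.log R) (hR0 : 0 < R) {N w : ℕ} (hN : 1 ≤ N)
    (hNR : Real.log N ≤ R * Real.log R) {b : Fin m → ℕ} (hb : ∀ j, 1 ≤ b j ∧ b j ≤ primorial w)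
    {h k : Fin m → ℤ} (hh : ∀ j, |h j| ≤ N)
    (hk : ∀ j, (midPrimorial w ⌊R⌋₊ : ℤ) ∣ (primorial w : ℤ) * k j + 1 - b j)
    (hkb : ∀ j, 0 ≤ k j ∧ k j ≤ (midPrimorial w ⌊R⌋₊ : ℤ) * (1 + m * (2 * N + midPrimorial w ⌊R⌋₊ + 1)))
    (hdist : ∀ j j', j ≠ j' → (h j, b j) ≠ (h j', b j')) (he : Function.Injective (fun j => h j + k j)) :
    excSum w (fun j => h j + k j) ≤
      ∑ p ∈ pairs m, ∑ q ∈ roughPrimeFactors w ((primorial w : ℤ) * (h p.1 - h p.2) + b p.1 - b p.2).natAbs,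
          (q : ℝ) ^ (-(1 / 2 : ℝ)) + #(pairs m) * (Real.log (6 * m) + 4) := by
  classical
  refine (excSum_le_sum_pairs w he).trans ?_
  have hsum : ∑ p ∈ pairs m, (∑ q ∈ roughPrimeFactors w ((primorial w : ℤ) * (h p.1 - h p.2) + b p.1 - b p.2).natAbs,
      (q : ℝ) ^ (-(1 / 2 : ℝ)) + (Real.log (6 * m) + 4)) =
      ∑ p ∈ pairs m, ∑ q ∈ roughPrimeFactors w ((primorial w : ℤ) * (h p.1 - h p.2) + b p.1 - b p.2).natAbs,
          (q : ℝ) ^ (-(1 / 2 : ℝ)) + #(pairs m) * (Real.log (6 * m) + 4) := by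
    rw [sum_add_distrib, sum_const, nsmul_eq_mul]
  rw [← hsum]
  refine sum_le_sum fun p hp => ?_
  have hii' : p.1 ≠ p.2 := (mem_pairs.1 hp).ne
  have hf : (h p.1 + k p.1) - (h p.2 + k p.2) ≠ 0 := sub_ne_zero.2 fun h0 => hii' (he h0)
  have hΔ : ((primorial w : ℕ) : ℤ) * (h p.1 - h p.2) + b p.1 - b p.2 ≠ 0 := delta_ne_zero hb (hdist _ _ hii')
  rw [← sum_filter_add_sum_filter_not (roughPrimeFactors w ((h p.1 + k p.1) - (h p.2 + k p.2)).natAbs) (fun q => q ≤ ⌊R⌋₊)]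
  refine add_le_add (sum_small_le_roughSum rfl hk hΔ) ?_
  refine le_trans (sum_le_sum_of_subset_of_nonneg ?_ fun q _ _ => by positivity) (parasitic_le hm hR1 hR0 hN hNR hh hkb hf)
  intro q hq
  rw [mem_filter] at hq ⊢
  unfold roughPrimeFactors at hq
  exact ⟨(mem_filter.1 hq.1).1, Nat.lt_of_floor_lt (not_le.1 hq.2)⟩

end XBound


/-! ### Assembly of the correlation display -/

section Main

variable {χ : ℝ → ℝ}

/-- `Icc lo hi ⊆ Ico (-N) (N + 1)` for `-N ≤ lo`, `hi ≤ N`. [folklore] -/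
theorem Icc_subset_Ico_window {N : ℕ} {lo hi : ℤ} (hlo : -(N : ℤ) ≤ lo) (hhi : hi ≤ N) :
    Finset.Icc lo hi ⊆ Finset.Ico (-(N : ℤ)) (-(N : ℤ) + ((2 * N + 1 : ℕ) : ℤ)) := by
  intro n hn
  rw [Finset.mem_Icc] at hn
  rw [Finset.mem_Ico]
  push_cast
  constructor <;> linarith

/-- `R^{5m} ≤ N` for `R = N^γ`, `γ ≤ 1/(10m)`, `N ≥ 1`. [folklore] -/
theorem rpow_five_le {N : ℕ} (hN : 1 ≤ N) {γ : ℝ} {m : ℕ} (hmγ : 5 * m * γ ≤ 1) :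
    ((N : ℝ) ^ γ) ^ (5 * m) ≤ N := by
  have hN1 : (1 : ℝ) ≤ N := by exact_mod_cast hN
  rw [← Real.rpow_natCast, ← Real.rpow_mul (by linarith)]
  calc (N : ℝ) ^ (γ * (5 * m : ℕ)) ≤ (N : ℝ) ^ (1 : ℝ) :=
        Real.rpow_le_rpow_of_exponent_le hN1 (by push_cast; nlinarith)
    _ = N := Real.rpow_one _

/-- `log N ≤ R log R` for `R = N^γ` once `N^γ ≥ 1/γ` and `log R ≥ 1`. [folklore] -/
theorem log_le_mul_log {N : ℕ} (hN : 1 ≤ N) {γ : ℝ} (hγ : 0 < γ) (hNγ : 1 / γ ≤ (N : ℝ) ^ γ) :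
    Real.log N ≤ (N : ℝ) ^ γ * Real.log ((N : ℝ) ^ γ) := by
  have hN0 : (0 : ℝ) < N := by exact_mod_cast (show 0 < N by omega)
  have hlogN : 0 ≤ Real.log N := Real.log_nonneg (by exact_mod_cast hN)
  rw [Real.log_rpow hN0]
  calc Real.log N = 1 * Real.log N := (one_mul _).symm
    _ ≤ ((N : ℝ) ^ γ * γ) * Real.log N := by
        refine mul_le_mul_of_nonneg_right ?_ hlogN
        rw [div_le_iff₀ hγ] at hNγ; linarith
    _ = (N : ℝ) ^ γ * (γ * Real.log N) := by ring

/-- **The correlation display for cutoffs with `|χ| ≤ 1`.** [cite: GreenTao2010, App. D (proof of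
Prop. 6.4, the correlation estimate, from Thm. D.3)] [cite: ConlonFoxZhao2014, Section 9] -/
theorem correlations_of_abs_le_one (m : ℕ) (hm : 2 ≤ m) {χ : ℝ → ℝ} (hχ : IsSmoothCompactCutoff χ)
    (hχ1 : ∀ x, |χ x| ≤ 1) :
    ∃ γ₀ : ℝ, 0 < γ₀ ∧ ∀ γ : ℝ, 0 < γ → γ ≤ γ₀ → ∃ C : ℝ, 0 < C ∧ ∃ w₀ N₀ : ℕ,
      ∀ N : ℕ, N₀ ≤ N → ∀ w : ℕ, w₀ ≤ w → (w : ℝ) ≤ Real.log (Real.log N) / 2 →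
      ∀ b : Fin m → ℕ, (∀ j, 1 ≤ b j ∧ b j ≤ primorial w ∧ Nat.Coprime (b j) (primorial w)) →
      ∀ h : Fin m → ℤ, (∀ j, |h j| ≤ N) → (∀ j j', j ≠ j' → (h j, b j) ≠ (h j', b j')) →
      ∀ lo hi : ℤ, -(N : ℤ) ≤ lo → hi ≤ N →
        ((Nat.totient (primorial w) : ℝ) / primorial w) ^ m *
            ∑ n ∈ Finset.Icc lo hi,
              ∏ j, truncDivisorSum χ ((N : ℝ) ^ γ) 2 ((primorial w : ℤ) * (n + h j) + b j) ≤
          C * N * ∑ j : Fin m, ∑ j' : Fin m,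
            if j < j' then
              Real.exp (C * ∑ p ∈ roughPrimeFactors w
                (Int.natAbs ((primorial w : ℤ) * (h j - h j') + b j - b j')), (p : ℝ) ^ (-(1 / 2 : ℝ)))
            else 0 := by
  have hs : ContDiff ℝ (⊤ : ℕ∞) χ := hχ.contDiff
  have hsupp : ∀ x, 1 ≤ |x| → χ x = 0 := hχ.eq_zero_of_one_le_abs
  have hm1 : 1 ≤ m := by omega
  obtain ⟨δ₀, K₀, hδ₀pos, hK₀, hζ⟩ := norm_zetaRatio_sub_le
  obtain ⟨CD, hCD0, hDomAll⟩ := exists_corr_dominator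
  obtain ⟨K₁, hK₁, hsmall⟩ := corr_smallness m hδ₀pos hK₀
  refine ⟨1 / (10 * m), by positivity, fun γ hγ hγ₀ => ?_⟩
  -- constants
  set M₂ := ∫ x, phiWeight χ x with hM₂_def
  set MA := weightMoment χ (14 * m + 2) with hMA_def
  set dC := deltaConst m with hdC_def
  set P : ℕ := #(pairs m) with hP_def
  set C₁ : ℝ := 4 * M₂ ^ (2 * m) + (1 + CD) ^ (3 * m) * ((2 * m : ℕ) * MA * M₂ ^ (2 * m - 1)) + 1 with hC₁_def
  set C₂ : ℝ := P * (Real.log (6 * m) + 4) with hC₂_def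
  set Cmain : ℝ := 3 * C₁ * Real.exp dC * Real.exp (dC * C₂) with hCmain_def
  have hM₂0 : 0 ≤ M₂ := integral_nonneg (phiWeight_nonneg χ)
  have hMA0 : 0 ≤ MA := weightMoment_nonneg χ _
  have hdC0 : 0 ≤ dC := deltaConst_nonneg m
  have hC₁0 : 0 < C₁ := by positivity
  have hCmain0 : 0 < Cmain := by positivity
  have hPpos : 0 < P := card_pos.2 (pairs_nonempty hm)
  refine ⟨max Cmain (P * dC), lt_max_of_lt_left hCmain0, 21 * m + 2, ?_⟩
  obtain ⟨N₁, hN₁⟩ := exists_loglog_le hγ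
  refine ⟨max (max 1 N₁) (max ⌈Real.exp (K₁ / γ)⌉₊ ⌈(1 / γ) ^ (1 / γ)⌉₊), ?_⟩
  intro N hN w hw hwlog b hb h hh hdist lo hi hlo hhi
  -- unpacking `N ≥ N₀`
  have hN1 : 1 ≤ N := le_trans ((le_max_left _ _).trans (le_max_left _ _)) hN
  have hNN₁ : N₁ ≤ N := le_trans ((le_max_right _ _).trans (le_max_left _ _)) hN
  have hNK : ⌈Real.exp (K₁ / γ)⌉₊ ≤ N := le_trans ((le_max_left _ _).trans (le_max_right _ _)) hN
  have hNγ' : ⌈(1 / γ) ^ (1 / γ)⌉₊ ≤ N := le_trans ((le_max_right _ _).trans (le_max_right _ _)) hN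
  have hN0 : (0 : ℝ) < N := by exact_mod_cast (show 0 < N by omega)
  have hN1' : (1 : ℝ) ≤ N := by exact_mod_cast hN1
  -- the level
  set R : ℝ := (N : ℝ) ^ γ with hR_def
  have hR0 : 0 < R := Real.rpow_pos_of_pos hN0 γ
  have hlogR : Real.log R = γ * Real.log N := Real.log_rpow hN0 γ
  have hK₁R : K₁ ≤ Real.log R := by rw [hlogR]; exact le_mul_log_of_le hγ hNK
  have hK1 : 1 ≤ Real.log R := hK₁.trans hK₁R
  have hwK : (w : ℝ) ≤ Real.log R ^ (1 / 8 : ℝ) := by rw [hlogR]; exact hwlog.trans (hN₁ N hNN₁)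
  have hw1 : 1 ≤ w := by omega
  have hR5 : R ^ (5 * m) ≤ N := rpow_five_le hN1 (by
    have : 5 * (m : ℝ) * (1 / (10 * m)) = 1 / 2 := by field_simp; ring
    calc 5 * (m : ℝ) * γ ≤ 5 * m * (1 / (10 * m)) := by gcongr
      _ = 1 / 2 := this
      _ ≤ 1 := by norm_num)
  have hNγ : 1 / γ ≤ R := by
    have h1 : ((1 / γ) ^ (1 / γ) : ℝ) ≤ N := (Nat.le_ceil _).trans (by exact_mod_cast hNγ')
    have h2 : (0 : ℝ) ≤ (1 / γ) ^ (1 / γ) := by positivity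
    calc 1 / γ = ((1 / γ) ^ (1 / γ)) ^ γ := by
          rw [← Real.rpow_mul (by positivity), one_div_mul_cancel hγ.ne', Real.rpow_one]
      _ ≤ (N : ℝ) ^ γ := Real.rpow_le_rpow h2 h1 hγ.le
  have hNR : Real.log N ≤ R * Real.log R := log_le_mul_log hN1 hγ hNγ
  -- smallness
  obtain ⟨hδ₀, hδw, hβ, hα⟩ := hsmall R hK₁R w hw1 hwK
  -- the shifts
  obtain ⟨k, hk, he, hkb⟩ := exists_good_shifts w ⌊R⌋₊ N b h hh
  have hb' : ∀ j, Nat.Coprime (b j) (primorial w) := fun j => (hb j).2.2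
  have hb'' : ∀ j, 1 ≤ b j ∧ b j ≤ primorial w := fun j => ⟨(hb j).1, (hb j).2.1⟩
  -- the fixed-data bound on the full window
  have hfix := corr_fixed_bound hs hsupp hχ1 hR0 hK1 hN1 hR5 hw hb' hk he hK₀ hζ hδ₀ hδw hβ hα hCD0
    (hDomAll m R hR0 hK1 w hw _ he)
  -- monotonicity in the interval
  have hφ0 : 0 ≤ ((Nat.totient (primorial w) : ℝ) / primorial w) ^ m := by positivity
  have hmono : ∑ n ∈ Finset.Icc lo hi, ∏ j, truncDivisorSum χ R 2 ((primorial w : ℤ) * (n + h j) + b j) ≤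
      ∑ n ∈ Finset.Ico (-(N : ℤ)) (-(N : ℤ) + ((2 * N + 1 : ℕ) : ℤ)),
        ∏ j, truncDivisorSum χ R 2 ((primorial w : ℤ) * (n + h j) + b j) := by
    refine sum_le_sum_of_subset_of_nonneg (Icc_subset_Ico_window hlo hhi) fun n _ _ => ?_
    have hR1 : 1 ≤ R := by
      have : 1 < R := by
        by_contra hc; have := Real.log_nonpos hR0.le (not_lt.1 hc); linarith
      exact this.le
    exact prod_nonneg fun j _ => mul_nonneg (Real.log_nonneg hR1) (sq_nonneg _)
  -- the exceptional sum
  have hX := excSum_le_pairs_roughSum hm hK1 hR0 hN1 hNR hb'' hh hk hkb hdist he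
  set Y : Fin m × Fin m → ℝ := fun p =>
    ∑ q ∈ roughPrimeFactors w ((primorial w : ℤ) * (h p.1 - h p.2) + b p.1 - b p.2).natAbs, (q : ℝ) ^ (-(1 / 2 : ℝ)) with hY_def
  have hY0 : ∀ p, 0 ≤ Y p := fun p => sum_nonneg fun q _ => by positivity
  have hexpX : Real.exp (dC * excSum w (fun j => h j + k j)) ≤ Real.exp (dC * C₂) * ∑ p ∈ pairs m, Real.exp (P * dC * Y p) := by
    calc Real.exp (dC * excSum w (fun j => h j + k j)) ≤ Real.exp (dC * (∑ p ∈ pairs m, Y p + C₂)) := by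
          refine Real.exp_le_exp.2 (mul_le_mul_of_nonneg_left ?_ hdC0)
          rw [hC₂_def, hP_def]; exact hX
      _ = Real.exp (dC * C₂) * Real.exp (dC * ∑ p ∈ pairs m, Y p) := by rw [← Real.exp_add]; ring_nf
      _ ≤ Real.exp (dC * C₂) * ∑ p ∈ pairs m, Real.exp (P * dC * Y p) := by
          refine mul_le_mul_of_nonneg_left ?_ (Real.exp_pos _).le
          have := exp_mul_sum_le_sum_exp (pairs_nonempty hm) dC Y
          rwa [← hP_def] at this
  -- the final constant
  set C := max Cmain (P * dC) with hC_def
  have hCm : Cmain ≤ C := le_max_left _ _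
  have hCP : (P : ℝ) * dC ≤ C := le_max_right _ _
  have hC0 : 0 ≤ C := hCmain0.le.trans hCm
  have hsumY : ∑ p ∈ pairs m, Real.exp (P * dC * Y p) ≤ ∑ p ∈ pairs m, Real.exp (C * Y p) :=
    sum_le_sum fun p _ => Real.exp_le_exp.2 (mul_le_mul_of_nonneg_right hCP (hY0 p))
  have hsum_ite : ∑ p ∈ pairs m, Real.exp (C * Y p) = ∑ j : Fin m, ∑ j' : Fin m,
      if j < j' then Real.exp (C * Y (j, j')) else 0 := sum_pairs_eq_sum_ite _
  calc ((Nat.totient (primorial w) : ℝ) / primorial w) ^ m *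
        ∑ n ∈ Finset.Icc lo hi, ∏ j, truncDivisorSum χ R 2 ((primorial w : ℤ) * (n + h j) + b j)
      ≤ ((Nat.totient (primorial w) : ℝ) / primorial w) ^ m *
        ∑ n ∈ Finset.Ico (-(N : ℤ)) (-(N : ℤ) + ((2 * N + 1 : ℕ) : ℤ)),
          ∏ j, truncDivisorSum χ R 2 ((primorial w : ℤ) * (n + h j) + b j) := mul_le_mul_of_nonneg_left hmono hφ0
    _ ≤ 3 * C₁ * (Real.exp dC * Real.exp (dC * excSum w (fun j => h j + k j))) * N := hfix
    _ ≤ 3 * C₁ * (Real.exp dC * (Real.exp (dC * C₂) * ∑ p ∈ pairs m, Real.exp (P * dC * Y p))) * N := by gcongr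
    _ = Cmain * N * ∑ p ∈ pairs m, Real.exp (P * dC * Y p) := by rw [hCmain_def]; ring
    _ ≤ C * N * ∑ p ∈ pairs m, Real.exp (C * Y p) :=
        mul_le_mul (mul_le_mul_of_nonneg_right hCm hN0.le) hsumY (sum_nonneg fun p _ => (Real.exp_pos _).le)
          (by positivity)
    _ = C * N * ∑ j : Fin m, ∑ j' : Fin m, if j < j' then Real.exp (C * Y (j, j')) else 0 := by rw [hsum_ite]

/-- **Green–Tao 2010, App. D — the correlation estimate for the enveloping sieve, PROVED** (the named
fact `GreenTao2010_envelopingSieve_correlations` of `LinearEquationsInPrimesEnvelopingSieveFacts.lean`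
discharged): by scaling `χ = sχ₁`, `|χ₁| ≤ 1` (`Λ_{χ,R,2} = s²Λ_{χ₁,R,2}`) this is
`correlations_of_abs_le_one`. [cite: GreenTao2010, App. D (proof of Prop. 6.4, the correlation
estimate) and Thm. D.3] [cite: ConlonFoxZhao2014, Section 9] -/
theorem _root_.Literature.NumberTheory.Sieve.GreenTao2010_envelopingSieve_correlations_holds :
    GreenTao2010_envelopingSieve_correlations := by
  intro m χ hm hχ
  obtain ⟨s, hs1, hsχ⟩ := exists_bound_cutoff hχ
  have hs0 : 0 < s := by linarith
  set χ₁ : ℝ → ℝ := fun x => s⁻¹ * χ x with hχ₁_def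
  have hχ₁ : IsSmoothCompactCutoff χ₁ := isSmoothCompactCutoff_smul s⁻¹ hχ
  have hχ₁1 : ∀ x, |χ₁ x| ≤ 1 := fun x => by
    simp only [hχ₁_def, abs_mul, abs_inv, abs_of_pos hs0]
    rw [inv_mul_le_iff₀ hs0, mul_one]
    exact hsχ x
  have hχeq : (fun x => s * χ₁ x) = χ := by
    funext x
    simp only [hχ₁_def]
    rw [mul_inv_cancel_left₀ hs0.ne']
  have ht : ∀ (R : ℝ) (y : ℤ), truncDivisorSum χ R 2 y = s ^ 2 * truncDivisorSum χ₁ R 2 y := fun R y => by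
    have := truncDivisorSum_two_smul s χ₁ R y
    rwa [hχeq] at this
  obtain ⟨γ₀, hγ₀, hmain⟩ := correlations_of_abs_le_one m hm hχ₁ hχ₁1
  refine ⟨γ₀, hγ₀, fun γ hγ hγγ₀ => ?_⟩
  obtain ⟨C, hC, w₀, N₀, h⟩ := hmain γ hγ hγγ₀
  refine ⟨max (C * (s ^ 2) ^ m) C, lt_max_of_lt_right hC, w₀, N₀,
    fun N hN w hw hwl b hb hh hhN hdist lo hi hlo hhi => ?_⟩
  have key := h N hN w hw hwl b hb hh hhN hdist lo hi hlo hhi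
  have hprod : ∀ nn : ℤ, ∏ j, truncDivisorSum χ ((N : ℝ) ^ γ) 2 ((primorial w : ℤ) * (nn + hh j) + b j) =
      (s ^ 2) ^ m * ∏ j, truncDivisorSum χ₁ ((N : ℝ) ^ γ) 2 ((primorial w : ℤ) * (nn + hh j) + b j) := by
    intro nn
    rw [prod_congr rfl fun j _ => ht _ _, prod_mul_distrib, prod_const, card_univ, Fintype.card_fin]
  rw [sum_congr rfl fun nn _ => hprod nn, ← mul_sum]
  set Ssum := ∑ nn ∈ Finset.Icc lo hi, ∏ j, truncDivisorSum χ₁ ((N : ℝ) ^ γ) 2 ((primorial w : ℤ) * (nn + hh j) + b j)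
  set RHS := fun C' : ℝ => ∑ j : Fin m, ∑ j' : Fin m, if j < j' then Real.exp (C' * ∑ p ∈ roughPrimeFactors w
      (Int.natAbs ((primorial w : ℤ) * (hh j - hh j') + b j - b j')), (p : ℝ) ^ (-(1 / 2 : ℝ))) else 0 with hRHS
  have hmonoRHS : ∀ C' C'' : ℝ, C' ≤ C'' → RHS C' ≤ RHS C'' := by
    intro C' C'' hle
    simp only [hRHS]
    refine sum_le_sum fun j _ => sum_le_sum fun j' _ => ?_
    split_ifs
    · exact Real.exp_le_exp.2 (mul_le_mul_of_nonneg_right hle (sum_nonneg fun p _ => by positivity))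
    · exact le_rfl
  have hRHS0 : ∀ C', 0 ≤ RHS C' := fun C' => sum_nonneg fun j _ => sum_nonneg fun j' _ => by
    split_ifs
    · exact (Real.exp_pos _).le
    · exact le_rfl
  have hN0 : (0 : ℝ) ≤ N := Nat.cast_nonneg _
  calc ((Nat.totient (primorial w) : ℝ) / primorial w) ^ m * ((s ^ 2) ^ m * Ssum)
      = (s ^ 2) ^ m * (((Nat.totient (primorial w) : ℝ) / primorial w) ^ m * Ssum) := by ring
    _ ≤ (s ^ 2) ^ m * (C * N * RHS C) := mul_le_mul_of_nonneg_left key (by positivity)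
    _ = (C * (s ^ 2) ^ m) * N * RHS C := by ring
    _ ≤ max (C * (s ^ 2) ^ m) C * N * RHS (max (C * (s ^ 2) ^ m) C) := by
        refine mul_le_mul (mul_le_mul_of_nonneg_right (le_max_left _ _) hN0) (hmonoRHS _ _ (le_max_right _ _))
          (hRHS0 _) (by positivity)

end Main

end EnvelopingSieveGY

end Literature.NumberTheory.Sieve
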